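import Literature.MathematicalPhysics.QuantumLattice.FermiRG.BGM2006Sec2ShellSupport
import Literature.MathematicalPhysics.QuantumLattice.SectorProductSymbolDecay
import Literature.Analysis.Calculus.IteratedDerivCompBound
import Literature.Analysis.Calculus.LineRestrictionIteratedDeriv
import Literature.Analysis.Calculus.NewtonForwardInterpolation
import Literature.Analysis.Calculus.IteratedDifferenceDerivBound
import HarnessLib

/-!
# Benfatto–Giuliani–Mastropietro 2006, §2.5: the single-scale integrand `F_{h,ω}/D_{h-1}` along rescaled
lines — all-order derivative bounds for a MOVING dispersion (proof of Lemmas 2.2/2.3, second part)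

Companion proof file of `BGM2006Sec2Setup.lean` / `BGM2006Sec2ShellSupport.lean` (typer-wave file F1a of
the cell `gate-hubbard-kl`; source BGM06 = G. Benfatto, A. Giuliani, V. Mastropietro, *Fermi liquid behavior
in the 2D Hubbard model at low temperatures*, Ann. Henri Poincaré **7** (2006) 809–898,
arXiv:cond-mat/0507686; locators `p00NN:Lnn` = chunk/line of the `lit read` render of the arXiv TeX).

The decay bounds (2.52)/(2.60) of Lemmas 2.2/2.3 (named facts `BGM2006_Lemma_2_2`, `BGM2006_Lemma_2_3`)
are obtained in print by "integrating by parts" the sector propagator (2.49) against "the dimensional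
bound for the integrand": each derivative of `F_{h,ω}(k)/D_{h-1}(k)` along `x'₁`/`x⃗`, and each discrete
`k₀`-derivative (the `d_β(x₀)` of (2.52), Matsubara summation by parts), costs a factor `γ^{-h}`
(p0010:L129–p0011:L33, with the tangential subtlety (2.53)–(2.55) for the anisotropic sectors).  For a
FIXED dispersion the tree proves this by compactness in rescaled coordinates
(`SectorSymbolMasterSmooth`); for BGM's scale-dependent `E_h` — an arbitrary family controlled only by the
inductive bounds (2.36), smooth in `k⃗` but DISCRETE in `k₀` — this file proves the quantitative version:

* §1 globally smooth SURROGATES of the three non-smooth ingredients: `G(u) = H₀(√u)` (`bgmCutoffSq`, so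
  that `H₀(γ^{-h}|D_h|) = G(|γ^{-h}D_h|²)`), the shell `f_h` as `G(|a|²) - G(16|b|²)` of the rescaled
  denominators `a = γ^{-h}D_h`, `b = γ^{-h}D_{h-1}` (`bgmShellSurrogate_eq_bgmShell`), and `1/D_{h-1}`
  as `γ^{-h} conj(b) η(|b|²)` with the tree's smooth inverse cutoff `η = sectorInvCutoff`
  (`bgmInvSurrogate`, `inv_bgmDenom_eq_surrogate`: exact on the support by (2.42a)); pointwise
  `F_{h,ω}/D_{h-1} = [shell · ζ_{m,ω}] · γ^{-h} inv` (`sectorIntegrand_eq_surrogate`);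
* §2–§3 a one-variable toolkit (derivatives through `Re`, `Im`, `conj`, `ofReal`, squared moduli, bounds
  on compacta) and the CORE estimate `exists_norm_iteratedDeriv_surrogateProduct_le`: all derivatives of
  order `≤ N` of `σ ↦ [shell(a(σ), b(σ)) z(σ)] inv(b(σ))` are bounded by `K(N, e₀, M, Z)` as soon as those
  of `a, b` (resp. `z`) are bounded by `M` (resp. `Z`) — Leibniz (`IteratedDerivLeibnizBound`) and Faà di
  Bruno (`IteratedDerivCompBound`), no lower bound on `|b|` needed;
* §4 the momentum directions: (2.36) telescoped from `E_0 = ε₀` along lines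
  (`norm_iteratedDeriv_dispersion_line_le`; multilinear bookkeeping `norm_apply_const_le_pow_mul_sum`),
  every derivative of `γ^{-h}E_{h'}(k₀, q⃗ + σγ^h v)` is `O(1)` (`norm_iteratedDeriv_rescaled_dispersion_line_le`,
  with `|U||h_β| ≤ c₀`), the closure of the support (`closure_support_bounds`), the plateaued angular
  factor (`norm_iteratedDeriv_angular_line_le`, from `AngularCutoffLineBounds`; `γ^h ≤ w_m` makes it
  uniform for BOTH the anisotropic and the isotropic sectors), and the export
  **`exists_norm_iteratedDeriv_bgmSurrogateIntegrand_line_le`**: all `σ`-derivatives of order `≤ N` of the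
  surrogate integrand `Φ̃` (`bgmSurrogateIntegrand`, `= γ^h F_{h,ω}/D_{h-1}` on the support) along
  `q⃗ + σγ^h v` at points of the closure of the support are `≤ K`, uniformly in `β, U, h, ω, k₀, q⃗, v`;
* §5 the Matsubara direction: (2.36aa) is Mathlib's forward difference (`bgmTimeDiffIter_eq_fwdDiff`),
  the telescoped discrete bounds (`norm_fwdDiff_dispersion_le`), the Newton interpolant of
  `k₀ ↦ E_{h'}(k₀, q⃗)` through `N+1` consecutive frequencies (`Analysis/Calculus/NewtonForwardInterpolation`)
  has rescaled derivatives `O(1)` when `2π/β ≤ 16e₀γ^h` (`norm_iteratedDeriv_newton_dispersion_le`), the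
  window is crossed by the mean value theorem (`norm_le_of_deriv_window`), and the export
  **`exists_norm_fwdDiff_sectorIntegrand_le`**: `‖Δ₁ᴺ(j ↦ F_{h,ω}(k₀(j), q⃗)/D_{h-1}(k₀(j), q⃗))(j₀)‖ ≤
  K (2π/β)ᴺ γ^{-h} γ^{-Nh}` (`Analysis/Calculus/IteratedDifferenceDerivBound`).

The assembly of (2.60) (Fourier side, support volumes, Matsubara summation by parts, the final constant)
is the business of the next file.  Everything here is a definition with a body (the four surrogates,
analysis devices `[folklore]`) or a proved theorem: no `sorry`, no axioms beyond the standard three, no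
named facts, no instances, no notation.

## Sources

* [BGM06] G. Benfatto, A. Giuliani, V. Mastropietro, Ann. Henri Poincaré 7 (2006) 809–898,
  arXiv:cond-mat/0507686, §2.3 (2.28), (2.36)–(2.36aa), §2.4 (2.41a)–(2.42a), §2.5 (2.45)–(2.49),
  Lemma 2.2 (2.52) with its proof p0010:L129–p0011:L33, Lemma 2.3 (2.60). [BenfattoGiulianiMastropietro2006]
-/

noncomputable section

open Real Set Filter Literature.Analysis.Calculus Literature.Analysis.SpecialFunctions
open scoped Nat Topology ComplexConjugate

namespace Literature.MathematicalPhysics.QuantumLattice.FermiRG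

/-! ### §1 Smooth surrogates of the cutoffs and of `1/D` -/

/-- `G(u) = H₀(√u)`: the Gallavotti–Nicolò cutoff as a function of the SQUARED modulus — smooth on all
of `ℝ` because `H₀ ≡ 1` near `0` ((2.9)). [cite: BenfattoGiulianiMastropietro2006, §2.2 (2.9) p0006:L71] -/
def bgmCutoffSq (e₀ u : ℝ) : ℝ := gnCutoff 4 e₀ (Real.sqrt u)

/-- `G` is smooth (because `H₀ ≡ 1` on `[0, e₀/γ]`, (2.9)). [cite: BenfattoGiulianiMastropietro2006, §2.2 (2.9) p0006:L71] -/
theorem contDiff_bgmCutoffSq {e₀ : ℝ} (he : 0 < e₀) {m : ℕ∞} : ContDiff ℝ m (bgmCutoffSq e₀) := by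
  have hg : ContDiff ℝ m fun t : ℝ => 1 - gnCutoff 4 e₀ t := contDiff_const.sub (contDiff_gnCutoff 4 e₀)
  have h0 : ∀ t ≤ e₀ / 4, (fun t : ℝ => 1 - gnCutoff 4 e₀ t) t = 0 := fun t ht => by
    simp only [gnCutoff_eq_one (by norm_num : (1 : ℝ) < 4) he ht, sub_self]
  have h := contDiff_comp_sqrt_of_eq_zero hg (by positivity : 0 < e₀ / 4) h0
  have he' : bgmCutoffSq e₀ = fun u => 1 - (fun t : ℝ => 1 - gnCutoff 4 e₀ t) (Real.sqrt u) := by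
    funext u; simp [bgmCutoffSq]
  rw [he']
  exact contDiff_const.sub h

/-- `G(‖z‖²) = H₀(‖z‖)` ((2.9) as a function of the squared modulus). [cite: BenfattoGiulianiMastropietro2006, §2.2 (2.9) p0006:L71] -/
theorem bgmCutoffSq_norm_sq (e₀ : ℝ) (z : ℂ) : bgmCutoffSq e₀ (‖z‖ ^ 2) = gnCutoff 4 e₀ ‖z‖ := by
  rw [bgmCutoffSq, Real.sqrt_sq (norm_nonneg _)]

/-- `|G| ≤ 1` (`0 ≤ H₀ ≤ 1`, (2.9)). [cite: BenfattoGiulianiMastropietro2006, §2.2 (2.9) p0006:L71] -/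
theorem abs_bgmCutoffSq_le_one (e₀ u : ℝ) : |bgmCutoffSq e₀ u| ≤ 1 := by
  have h := gnCutoff_mem_Icc 4 e₀ (Real.sqrt u)
  rw [bgmCutoffSq, abs_le]; constructor <;> linarith [h.1, h.2]

/-- **The shell surrogate**: `G(|a|²) - G(16|b|²)`, which at `a = γ^{-h}D_h`, `b = γ^{-h}D_{h-1}` IS the
single-scale cutoff `f_h = H₀(γ^{-h}|D_h|) - H₀(γ^{-h+1}|D_{h-1}|)` of (2.28), as a smooth function of the
two (complex) denominators. [cite: BenfattoGiulianiMastropietro2006, §2.3 (2.28) p0007:L108] -/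
def bgmShellSurrogate (e₀ : ℝ) (a b : ℂ) : ℝ := bgmCutoffSq e₀ (‖a‖ ^ 2) - bgmCutoffSq e₀ (16 * ‖b‖ ^ 2)

/-- `|shell surrogate| ≤ 2` (`f_h` is a difference of two cutoffs in `[0, 1]`, (2.28)). [cite: BenfattoGiulianiMastropietro2006, §2.3 (2.28) p0007:L108] -/
theorem abs_bgmShellSurrogate_le (e₀ : ℝ) (a b : ℂ) : |bgmShellSurrogate e₀ a b| ≤ 2 := by
  rw [bgmShellSurrogate]
  have h1 := abs_bgmCutoffSq_le_one e₀ (‖a‖ ^ 2)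
  have h2 := abs_bgmCutoffSq_le_one e₀ (16 * ‖b‖ ^ 2)
  calc _ ≤ |bgmCutoffSq e₀ (‖a‖ ^ 2)| + |bgmCutoffSq e₀ (16 * ‖b‖ ^ 2)| := abs_sub _ _
    _ ≤ 2 := by linarith

/-- **The shell surrogate is the single-scale cutoff** (2.28) at the rescaled denominators
`a = γ^{-h}D_h(k)`, `b = γ^{-h}D_{h-1}(k)` (`γ = 4`). [cite: BenfattoGiulianiMastropietro2006, §2.3 (2.28) p0007:L108] -/
theorem bgmShellSurrogate_eq_bgmShell (e₀ μ : ℝ) (E : ℤ → ℝ × (Fin 2 → ℝ) → ℂ) (h : ℤ) (p : ℝ × (Fin 2 → ℝ)) :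
    bgmShellSurrogate e₀ ((((4 : ℝ) ^ (-h) : ℝ) : ℂ) * bgmDenom μ E h p)
        ((((4 : ℝ) ^ (-h) : ℝ) : ℂ) * bgmDenom μ E (h - 1) p) = bgmShell e₀ μ E h p := by
  have h4 : (0 : ℝ) < (4 : ℝ) ^ (-h) := zpow_pos (by norm_num) _
  have h16 : (16 : ℝ) * ‖(((4 : ℝ) ^ (-h) : ℝ) : ℂ) * bgmDenom μ E (h - 1) p‖ ^ 2 =
      ‖(4 : ℂ) * ((((4 : ℝ) ^ (-h) : ℝ) : ℂ) * bgmDenom μ E (h - 1) p)‖ ^ 2 := by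
    rw [norm_mul (4 : ℂ), mul_pow]; norm_num
  rw [bgmShellSurrogate, h16, bgmCutoffSq_norm_sq, bgmCutoffSq_norm_sq, bgmShell, bgmCutoffInv, bgmCutoffInv,
    gnScaleCutoff, gnScaleCutoff]
  congr 1
  · rw [norm_mul, Complex.norm_real, Real.norm_of_nonneg h4.le]
  · have hz : (4 : ℝ) ^ (-(h - 1)) = 4 * (4 : ℝ) ^ (-h) := by
      rw [show -(h - 1) = -h + 1 by ring, zpow_add_one₀ (by norm_num : (4 : ℝ) ≠ 0)]; ring
    rw [norm_mul, norm_mul, Complex.norm_real, Real.norm_of_nonneg h4.le, hz,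
      show ‖(4 : ℂ)‖ = 4 by simp]
    ring


/-- **The inverse surrogate**: `conj(b) · η(|b|²)` with the tree's smooth inverse cutoff
`η = sectorInvCutoff (e₀²/128)` (`η(q) = 1/q` for `q ≥ e₀²/256`): a smooth bounded function on all of `ℂ`
which IS `1/b` wherever `|b| ≥ e₀/16` — the range of the rescaled denominator `γ^{-h}D_{h-1}` on the
support of `f_h` ((2.42a): `|D_{h-1}| > e₀γ^{h-2}` there). [cite: BenfattoGiulianiMastropietro2006, §2.4 (2.42a) p0010:L9–L14] -/
def bgmInvSurrogate (e₀ : ℝ) (b : ℂ) : ℂ := conj b * ((sectorInvCutoff (e₀ ^ 2 / 128) (‖b‖ ^ 2) : ℝ) : ℂ)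

/-- The inverse surrogate is the inverse on `|b| ≥ e₀/16` (the range of `γ^{-h}D_{h-1}` on the support, (2.42a)). [cite: BenfattoGiulianiMastropietro2006, §2.4 (2.42a) p0010:L9–L14] -/
theorem bgmInvSurrogate_eq_inv {e₀ : ℝ} (he : 0 < e₀) {b : ℂ} (hb : e₀ / 16 ≤ ‖b‖) :
    bgmInvSurrogate e₀ b = b⁻¹ := by
  have hq₀ : 0 < e₀ ^ 2 / 128 := by positivity
  have hb2 : e₀ ^ 2 / 128 / 2 ≤ ‖b‖ ^ 2 := by
    have : (e₀ / 16) ^ 2 ≤ ‖b‖ ^ 2 := pow_le_pow_left₀ (by positivity) hb 2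
    nlinarith
  rw [bgmInvSurrogate, sectorInvCutoff_eq_inv hq₀ hb2, Complex.inv_def, Complex.normSq_eq_norm_sq]

/-- **`1/D_{h-1}` through the surrogate on the support of `f_h`**: if `f_h(k) ≠ 0` (and the dispersion
increment is below threshold) then `1/D_{h-1}(k) = γ^{-h} · invSurrogate(γ^{-h}D_{h-1}(k))`.
[cite: BenfattoGiulianiMastropietro2006, §2.4 (2.42a) p0010:L9–L14] -/
theorem inv_bgmDenom_eq_surrogate {e₀ μ : ℝ} (he : 0 < e₀) {E : ℤ → ℝ × (Fin 2 → ℝ) → ℂ} {h : ℤ}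
    {p : ℝ × (Fin 2 → ℝ)} (hη : ‖E h p - E (h - 1) p‖ ≤ 3 / 16 * e₀ * (4 : ℝ) ^ h)
    (hf : bgmShell e₀ μ E h p ≠ 0) :
    (bgmDenom μ E (h - 1) p)⁻¹ =
      (((4 : ℝ) ^ (-h) : ℝ) : ℂ) * bgmInvSurrogate e₀ ((((4 : ℝ) ^ (-h) : ℝ) : ℂ) * bgmDenom μ E (h - 1) p) := by
  have hlo := (norm_bgmDenom_bounds_of_bgmShell_ne_zero he hη hf).1
  have h4 : (0 : ℝ) < (4 : ℝ) ^ (-h) := zpow_pos (by norm_num) _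
  have h4h : (0 : ℝ) < (4 : ℝ) ^ h := zpow_pos (by norm_num) _
  have hz : (4 : ℝ) ^ (h - 2) = (4 : ℝ) ^ h / 16 := by
    rw [zpow_sub₀ (by norm_num : (4 : ℝ) ≠ 0)]; norm_num
  have hinv : (4 : ℝ) ^ (-h) * (4 : ℝ) ^ h = 1 := by
    rw [zpow_neg, inv_mul_cancel₀ h4h.ne']
  have hb : e₀ / 16 ≤ ‖(((4 : ℝ) ^ (-h) : ℝ) : ℂ) * bgmDenom μ E (h - 1) p‖ := by
    rw [norm_mul, Complex.norm_real, Real.norm_of_nonneg h4.le]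
    rw [hz] at hlo
    have := mul_le_mul_of_nonneg_left hlo.le h4.le
    calc e₀ / 16 = (4 : ℝ) ^ (-h) * (4 : ℝ) ^ h * (e₀ / 16) := by rw [hinv, one_mul]
      _ = (4 : ℝ) ^ (-h) * (e₀ * ((4 : ℝ) ^ h / 16)) := by ring
      _ ≤ _ := this
  have hne : ((((4 : ℝ) ^ (-h) : ℝ) : ℂ)) ≠ 0 := by exact_mod_cast h4.ne'
  rw [bgmInvSurrogate_eq_inv he hb, mul_inv, mul_inv_cancel_left₀ hne]

/-- **The sector integrand through the surrogates** (pointwise, every `k`): with `a = γ^{-h}D_h(k)`,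
`b = γ^{-h}D_{h-1}(k)`,  `F_{h,ω}(k)/D_{h-1}(k) = [shellSurrogate(a,b) · ζ_{m,ω}(θ(k⃗))] · γ^{-h} invSurrogate(b)`
(both sides vanish off the support of `f_h`). [cite: BenfattoGiulianiMastropietro2006, §2.5 (2.49) p0010:L72] -/
theorem sectorIntegrand_eq_surrogate {e₀ μ : ℝ} (he : 0 < e₀) {E : ℤ → ℝ × (Fin 2 → ℝ) → ℂ} {h : ℤ}
    {p : ℝ × (Fin 2 → ℝ)} (hη : ‖E h p - E (h - 1) p‖ ≤ 3 / 16 * e₀ * (4 : ℝ) ^ h) (m : ℕ) (ω : ℤ) :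
    ((bgmSectorFn e₀ μ E h m ω p : ℝ) : ℂ) / bgmDenom μ E (h - 1) p =
      ((bgmShellSurrogate e₀ ((((4 : ℝ) ^ (-h) : ℝ) : ℂ) * bgmDenom μ E h p)
          ((((4 : ℝ) ^ (-h) : ℝ) : ℂ) * bgmDenom μ E (h - 1) p) * sectorWeightCirc m ω (polarAngle p.2) : ℝ) : ℂ) *
        ((((4 : ℝ) ^ (-h) : ℝ) : ℂ) * bgmInvSurrogate e₀ ((((4 : ℝ) ^ (-h) : ℝ) : ℂ) * bgmDenom μ E (h - 1) p)) := by
  rw [bgmShellSurrogate_eq_bgmShell, bgmSectorFn]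
  by_cases hf : bgmShell e₀ μ E h p = 0
  · simp [hf]
  · rw [← inv_bgmDenom_eq_surrogate he hη hf, div_eq_mul_inv]

/-! ### §2 One-variable toolkit: bounded derivatives through linear maps, squares of moduli, compacta -/

/-- A common bound for finitely many orders. [folklore] -/
private theorem exists_forall_le_max {P : ℕ → ℝ → Prop} (hmono : ∀ i C C', C ≤ C' → P i C → P i C')
    (hex : ∀ i, ∃ C, 0 ≤ C ∧ P i C) (N : ℕ) : ∃ C, 0 ≤ C ∧ ∀ i ≤ N, P i C := by
  induction N with
  | zero =>
    obtain ⟨C, hC0, hC⟩ := hex 0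
    exact ⟨C, hC0, fun i hi => by rw [Nat.le_zero.1 hi]; exact hC⟩
  | succ N ih =>
    obtain ⟨C₁, h1, hC₁⟩ := ih
    obtain ⟨C₂, _, hC₂⟩ := hex (N + 1)
    refine ⟨max C₁ C₂, le_max_of_le_left h1, fun i hi => ?_⟩
    rcases Nat.lt_or_ge i (N + 1) with hlt | hge
    · exact hmono _ _ _ (le_max_left _ _) (hC₁ i (Nat.lt_succ_iff.1 hlt))
    · rw [le_antisymm hi hge]; exact hmono _ _ _ (le_max_right _ _) hC₂

/-- **Derivatives of a fixed smooth function are bounded on a compact interval**, all orders `≤ N` at once.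
[folklore] -/
private theorem exists_norm_iteratedDeriv_le_on_Icc {g : ℝ → ℝ} (hg : ∀ m : ℕ, ContDiff ℝ m g) (N : ℕ) (lo hi : ℝ) :
    ∃ C, 0 ≤ C ∧ ∀ i ≤ N, ∀ y ∈ Icc lo hi, ‖iteratedDeriv i g y‖ ≤ C := by
  refine exists_forall_le_max (P := fun i C => ∀ y ∈ Icc lo hi, ‖iteratedDeriv i g y‖ ≤ C)
    (fun i C C' hCC' hP y hy => (hP y hy).trans hCC') (fun i => ?_) N
  have hcont : Continuous (iteratedDeriv i g) := (hg i).continuous_iteratedDeriv' i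
  obtain ⟨C, hC⟩ := isCompact_Icc.exists_bound_of_continuousOn hcont.continuousOn
  exact ⟨max C 0, le_max_right _ _, fun y hy => (hC y hy).trans (le_max_left _ _)⟩

/-- A continuous linear map commutes with `iteratedDeriv`. [folklore] -/
private theorem iteratedDeriv_clm_apply {F G : Type*} [NormedAddCommGroup F] [NormedSpace ℝ F]
    [NormedAddCommGroup G] [NormedSpace ℝ G] (L : F →L[ℝ] G) {a : ℝ → F} {n : ℕ} (ha : ContDiff ℝ n a)
    {i : ℕ} (hi : i ≤ n) (σ : ℝ) : iteratedDeriv i (fun σ => L (a σ)) σ = L (iteratedDeriv i a σ) := by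
  rw [iteratedDeriv_eq_iteratedFDeriv, iteratedDeriv_eq_iteratedFDeriv,
    show (fun σ => L (a σ)) = L ∘ a from rfl,
    L.iteratedFDeriv_comp_left ha.contDiffAt (i := i) (by exact_mod_cast hi)]
  rfl

/-- Real parts: `∂ⁱ Re a = Re ∂ⁱ a`. [folklore] -/
private theorem iteratedDeriv_re_eq {a : ℝ → ℂ} {n : ℕ} (ha : ContDiff ℝ n a) {i : ℕ} (hi : i ≤ n) (σ : ℝ) :
    iteratedDeriv i (fun σ => (a σ).re) σ = (iteratedDeriv i a σ).re := by
  have h := iteratedDeriv_clm_apply Complex.reCLM ha hi σ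
  simpa only [Complex.reCLM_apply] using h

/-- Imaginary parts: `∂ⁱ Im a = Im ∂ⁱ a`. [folklore] -/
private theorem iteratedDeriv_im_eq {a : ℝ → ℂ} {n : ℕ} (ha : ContDiff ℝ n a) {i : ℕ} (hi : i ≤ n) (σ : ℝ) :
    iteratedDeriv i (fun σ => (a σ).im) σ = (iteratedDeriv i a σ).im := by
  have h := iteratedDeriv_clm_apply Complex.imCLM ha hi σ
  simpa only [Complex.imCLM_apply] using h

/-- Conjugates: `∂ⁱ conj a = conj ∂ⁱ a`. [folklore] -/
private theorem iteratedDeriv_conj_eq {a : ℝ → ℂ} {n : ℕ} (ha : ContDiff ℝ n a) {i : ℕ} (hi : i ≤ n) (σ : ℝ) :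
    iteratedDeriv i (fun σ => conj (a σ)) σ = conj (iteratedDeriv i a σ) := by
  have h := iteratedDeriv_clm_apply (Complex.conjCLE : ℂ →L[ℝ] ℂ) ha hi σ
  simpa only [ContinuousLinearEquiv.coe_coe, Complex.conjCLE_apply] using h

/-- Real embedding: `∂ⁱ (r : ℂ) = (∂ⁱ r : ℂ)`. [folklore] -/
private theorem iteratedDeriv_ofReal_eq {r : ℝ → ℝ} {n : ℕ} (hr : ContDiff ℝ n r) {i : ℕ} (hi : i ≤ n) (σ : ℝ) :
    iteratedDeriv i (fun σ => ((r σ : ℝ) : ℂ)) σ = ((iteratedDeriv i r σ : ℝ) : ℂ) := by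
  have h := iteratedDeriv_clm_apply Complex.ofRealCLM hr hi σ
  simpa only [Complex.ofRealCLM_apply] using h

/-- **The squared modulus of a smooth complex function**: if `‖a^{(j)}(σ)‖ ≤ M` for all `j ≤ n` then
`‖(|a|²)^{(i)}(σ)‖ ≤ 2^{i+1}M²` for `i ≤ n` (Leibniz on `Re² + Im²`). [folklore] -/
private theorem norm_iteratedDeriv_norm_sq_le {a : ℝ → ℂ} {n : ℕ} (ha : ContDiff ℝ n a) (σ : ℝ) {M : ℝ}
    (hM : ∀ j ≤ n, ‖iteratedDeriv j a σ‖ ≤ M) {i : ℕ} (hi : i ≤ n) :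
    ‖iteratedDeriv i (fun σ => ‖a σ‖ ^ 2) σ‖ ≤ 2 ^ (i + 1) * M ^ 2 := by
  have hre : ContDiff ℝ i fun σ => (a σ).re :=
    (Complex.reCLM.contDiff.comp ha).of_le (by exact_mod_cast hi)
  have him : ContDiff ℝ i fun σ => (a σ).im :=
    (Complex.imCLM.contDiff.comp ha).of_le (by exact_mod_cast hi)
  have hfun : (fun σ => ‖a σ‖ ^ 2) = fun σ => (a σ).re * (a σ).re + (a σ).im * (a σ).im := by
    funext σ; rw [Complex.sq_norm, Complex.normSq_apply]
  have hAre : ∀ j ≤ i, ‖iteratedDeriv j (fun σ => (a σ).re) σ‖ ≤ M * 1 ^ j := fun j hj => by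
    rw [iteratedDeriv_re_eq ha (hj.trans hi), one_pow, mul_one, Real.norm_eq_abs]
    exact (Complex.abs_re_le_norm _).trans (hM j (hj.trans hi))
  have hAim : ∀ j ≤ i, ‖iteratedDeriv j (fun σ => (a σ).im) σ‖ ≤ M * 1 ^ j := fun j hj => by
    rw [iteratedDeriv_im_eq ha (hj.trans hi), one_pow, mul_one, Real.norm_eq_abs]
    exact (Complex.abs_im_le_norm _).trans (hM j (hj.trans hi))
  have h1 := norm_iteratedDeriv_mul_le_of_geometric hre hre σ zero_le_one hAre hAre
  have h2 := norm_iteratedDeriv_mul_le_of_geometric him him σ zero_le_one hAim hAim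
  rw [hfun, iteratedDeriv_fun_add (hre.mul hre).contDiffAt (him.mul him).contDiffAt]
  calc _ ≤ ‖iteratedDeriv i (fun σ => (a σ).re * (a σ).re) σ‖ + ‖iteratedDeriv i (fun σ => (a σ).im * (a σ).im) σ‖ :=
        norm_add_le _ _
    _ ≤ 2 ^ i * M * M * 1 ^ i + 2 ^ i * M * M * 1 ^ i := add_le_add h1 h2
    _ = 2 ^ (i + 1) * M ^ 2 := by ring

/-! ### §3 The core estimate: all-order derivative bounds of the surrogate product along a line -/

/-- The shell surrogate (2.28) along a pair of smooth complex curves is smooth. [cite: BenfattoGiulianiMastropietro2006, §2.3 (2.28) p0007:L108] -/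
theorem contDiff_bgmShellSurrogate_comp {e₀ : ℝ} (he : 0 < e₀) {a b : ℝ → ℂ} {n : ℕ} (ha : ContDiff ℝ n a)
    (hb : ContDiff ℝ n b) : ContDiff ℝ n fun σ => bgmShellSurrogate e₀ (a σ) (b σ) := by
  unfold bgmShellSurrogate
  exact ((contDiff_bgmCutoffSq he).comp (ha.norm_sq ℝ)).sub
    ((contDiff_bgmCutoffSq he).comp (contDiff_const.mul (hb.norm_sq ℝ)))

/-- The inverse surrogate of `1/D_{h-1}` along a smooth complex curve is smooth. [cite: BenfattoGiulianiMastropietro2006, §2.4 (2.42a)–(2.43) p0010:L1–L14] -/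
theorem contDiff_bgmInvSurrogate_comp {e₀ : ℝ} (he : 0 < e₀) {b : ℝ → ℂ} {n : ℕ} (hb : ContDiff ℝ n b) :
    ContDiff ℝ n fun σ => bgmInvSurrogate e₀ (b σ) := by
  unfold bgmInvSurrogate
  have hq₀ : 0 < e₀ ^ 2 / 128 := by positivity
  exact (Complex.conjCLE.contDiff.comp hb).mul
    (Complex.ofRealCLM.contDiff.comp ((contDiff_sectorInvCutoff hq₀).comp (hb.norm_sq ℝ)))

/-- **The shell surrogate along smooth curves, all orders**: for every `N`, `M` there is `K` with
`‖∂ⁱ[shellSurrogate(a(σ), b(σ))]‖ ≤ K` (`i ≤ N`) whenever `‖a^{(j)}(σ)‖, ‖b^{(j)}(σ)‖ ≤ M` for all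
`j ≤ N` (Faà di Bruno through `G`, Leibniz for the squared moduli). [cite: BenfattoGiulianiMastropietro2006, §2.5 proof of Lemma 2.2 (2.53)–(2.55) p0011:L7–L20] -/
theorem exists_norm_iteratedDeriv_shellSurrogate_le {e₀ : ℝ} (he : 0 < e₀) (N : ℕ) (M : ℝ) :
    ∃ K : ℝ, 0 ≤ K ∧ ∀ (a b : ℝ → ℂ) (σ : ℝ), ContDiff ℝ N a → ContDiff ℝ N b →
      (∀ j ≤ N, ‖iteratedDeriv j a σ‖ ≤ M) → (∀ j ≤ N, ‖iteratedDeriv j b σ‖ ≤ M) →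
      ∀ i ≤ N, ‖iteratedDeriv i (fun σ => bgmShellSurrogate e₀ (a σ) (b σ)) σ‖ ≤ K := by
  set M₁ : ℝ := max M 1 with hM₁
  have hM1 : 1 ≤ M₁ := le_max_right _ _
  have hMM : M ≤ M₁ := le_max_left _ _
  set D : ℝ := 16 * (2 ^ (N + 1) * M₁ ^ 2) with hD
  have hD1 : 1 ≤ D := by
    have h2 : (1 : ℝ) ≤ 2 ^ (N + 1) := one_le_pow₀ (by norm_num)
    have : (1 : ℝ) ≤ M₁ ^ 2 := one_le_pow₀ hM1
    nlinarith
  obtain ⟨CG, hCG0, hCG⟩ := exists_norm_iteratedDeriv_le_on_Icc (g := bgmCutoffSq e₀)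
    (fun m => contDiff_bgmCutoffSq he) N 0 (16 * M₁ ^ 2)
  refine ⟨2 * (N ! * CG * D ^ N), by positivity, fun a b σ ha hb hMa hMb i hi => ?_⟩
  have hMa' : ∀ j ≤ N, ‖iteratedDeriv j a σ‖ ≤ M₁ := fun j hj => (hMa j hj).trans hMM
  have hMb' : ∀ j ≤ N, ‖iteratedDeriv j b σ‖ ≤ M₁ := fun j hj => (hMb j hj).trans hMM
  -- the two inner functions and their derivative bounds `≤ D ≤ D^j`
  have hua : ContDiff ℝ N fun σ => ‖a σ‖ ^ 2 := ha.norm_sq ℝ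
  have hub : ContDiff ℝ N fun σ => 16 * ‖b σ‖ ^ 2 := contDiff_const.mul (hb.norm_sq ℝ)
  have hDa : ∀ j, 1 ≤ j → j ≤ i → ‖iteratedDeriv j (fun σ => ‖a σ‖ ^ 2) σ‖ ≤ D ^ j := by
    intro j hj1 hj
    have h := norm_iteratedDeriv_norm_sq_le ha σ hMa' (hj.trans hi)
    have h2 : (2 : ℝ) ^ (j + 1) ≤ 2 ^ (N + 1) := pow_le_pow_right₀ (by norm_num) (by omega)
    calc _ ≤ 2 ^ (j + 1) * M₁ ^ 2 := h
      _ ≤ 2 ^ (N + 1) * M₁ ^ 2 := by gcongr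
      _ ≤ D := by rw [hD]; nlinarith [pow_nonneg (by positivity : (0 : ℝ) ≤ 2) (N + 1), sq_nonneg M₁]
      _ ≤ D ^ j := le_self_pow₀ hD1 (by omega)
  have hDb : ∀ j, 1 ≤ j → j ≤ i → ‖iteratedDeriv j (fun σ => 16 * ‖b σ‖ ^ 2) σ‖ ≤ D ^ j := by
    intro j hj1 hj
    have h := norm_iteratedDeriv_norm_sq_le hb σ hMb' (hj.trans hi)
    have h2 : (2 : ℝ) ^ (j + 1) ≤ 2 ^ (N + 1) := pow_le_pow_right₀ (by norm_num) (by omega)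
    rw [iteratedDeriv_const_mul (16 : ℝ) ((hb.norm_sq ℝ).contDiffAt.of_le (by exact_mod_cast hj.trans hi)),
      norm_mul, Real.norm_of_nonneg (by norm_num : (0 : ℝ) ≤ 16)]
    calc _ ≤ 16 * (2 ^ (j + 1) * M₁ ^ 2) := by gcongr
      _ ≤ D := by rw [hD]; gcongr
      _ ≤ D ^ j := le_self_pow₀ hD1 (by omega)
  -- the values lie in `[0, 16 M₁²]`
  have ha0 : ‖a σ‖ ≤ M₁ := by have := hMa' 0 (Nat.zero_le _); rwa [iteratedDeriv_zero] at this
  have hb0 : ‖b σ‖ ≤ M₁ := by have := hMb' 0 (Nat.zero_le _); rwa [iteratedDeriv_zero] at this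
  have hva : ‖a σ‖ ^ 2 ∈ Icc (0 : ℝ) (16 * M₁ ^ 2) := by
    refine ⟨by positivity, ?_⟩
    have := pow_le_pow_left₀ (norm_nonneg _) ha0 2
    nlinarith [sq_nonneg M₁]
  have hvb : 16 * ‖b σ‖ ^ 2 ∈ Icc (0 : ℝ) (16 * M₁ ^ 2) := by
    refine ⟨by positivity, ?_⟩
    have := pow_le_pow_left₀ (norm_nonneg _) hb0 2
    nlinarith
  -- Faà di Bruno for the two compositions
  have hfac : (i ! : ℝ) ≤ N ! := by exact_mod_cast Nat.factorial_le hi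
  have hDi : D ^ i ≤ D ^ N := pow_le_pow_right₀ hD1 hi
  have hGa : ‖iteratedDeriv i (bgmCutoffSq e₀ ∘ fun σ => ‖a σ‖ ^ 2) σ‖ ≤ N ! * CG * D ^ N := by
    have h := norm_iteratedDeriv_comp_le_of_contDiffOn isOpen_univ (mem_univ σ)
      (contDiff_bgmCutoffSq he (m := i)) (hua.of_le (by exact_mod_cast hi)).contDiffOn
      (fun j hj => hCG j (hj.trans hi) _ hva) hDa
    calc _ ≤ (i ! : ℝ) * CG * D ^ i := h
      _ ≤ N ! * CG * D ^ N := by gcongr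
  have hGb : ‖iteratedDeriv i (bgmCutoffSq e₀ ∘ fun σ => 16 * ‖b σ‖ ^ 2) σ‖ ≤ N ! * CG * D ^ N := by
    have h := norm_iteratedDeriv_comp_le_of_contDiffOn isOpen_univ (mem_univ σ)
      (contDiff_bgmCutoffSq he (m := i)) (hub.of_le (by exact_mod_cast hi)).contDiffOn
      (fun j hj => hCG j (hj.trans hi) _ hvb) hDb
    calc _ ≤ (i ! : ℝ) * CG * D ^ i := h
      _ ≤ N ! * CG * D ^ N := by gcongr
  have hcd1 : ContDiffAt ℝ i (bgmCutoffSq e₀ ∘ fun σ => ‖a σ‖ ^ 2) σ :=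
    ((contDiff_bgmCutoffSq he).comp (hua.of_le (by exact_mod_cast hi))).contDiffAt
  have hcd2 : ContDiffAt ℝ i (bgmCutoffSq e₀ ∘ fun σ => 16 * ‖b σ‖ ^ 2) σ :=
    ((contDiff_bgmCutoffSq he).comp (hub.of_le (by exact_mod_cast hi))).contDiffAt
  have hfun : (fun σ => bgmShellSurrogate e₀ (a σ) (b σ)) =
      (bgmCutoffSq e₀ ∘ fun σ => ‖a σ‖ ^ 2) - (bgmCutoffSq e₀ ∘ fun σ => 16 * ‖b σ‖ ^ 2) := by
    funext σ; simp [bgmShellSurrogate]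
  rw [hfun, iteratedDeriv_sub hcd1 hcd2]
  calc _ ≤ ‖iteratedDeriv i (bgmCutoffSq e₀ ∘ fun σ => ‖a σ‖ ^ 2) σ‖ +
        ‖iteratedDeriv i (bgmCutoffSq e₀ ∘ fun σ => 16 * ‖b σ‖ ^ 2) σ‖ := norm_sub_le _ _
    _ ≤ N ! * CG * D ^ N + N ! * CG * D ^ N := add_le_add hGa hGb
    _ = 2 * (N ! * CG * D ^ N) := by ring

/-- **The inverse surrogate along a smooth curve, all orders**: for every `N`, `M` there is `K` with
`‖∂ⁱ[invSurrogate(b(σ))]‖ ≤ K` (`i ≤ N`) whenever `‖b^{(j)}(σ)‖ ≤ M` for all `j ≤ N` — no lower bound on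
`|b|` is needed (the surrogate is smooth and bounded through `b = 0`). [cite: BenfattoGiulianiMastropietro2006, §2.5 proof of Lemma 2.2 (2.54)–(2.55) p0011:L12–L20] -/
theorem exists_norm_iteratedDeriv_invSurrogate_le {e₀ : ℝ} (he : 0 < e₀) (N : ℕ) (M : ℝ) :
    ∃ K : ℝ, 0 ≤ K ∧ ∀ (b : ℝ → ℂ) (σ : ℝ), ContDiff ℝ N b → (∀ j ≤ N, ‖iteratedDeriv j b σ‖ ≤ M) →
      ∀ i ≤ N, ‖iteratedDeriv i (fun σ => bgmInvSurrogate e₀ (b σ)) σ‖ ≤ K := by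
  set M₁ : ℝ := max M 1 with hM₁
  have hM1 : 1 ≤ M₁ := le_max_right _ _
  have hMM : M ≤ M₁ := le_max_left _ _
  set D : ℝ := 2 ^ (N + 1) * M₁ ^ 2 with hD
  have hD1 : 1 ≤ D := by
    have h2 : (1 : ℝ) ≤ 2 ^ (N + 1) := one_le_pow₀ (by norm_num)
    have : (1 : ℝ) ≤ M₁ ^ 2 := one_le_pow₀ hM1
    nlinarith
  have hq₀ : 0 < e₀ ^ 2 / 128 := by positivity
  obtain ⟨Cι, hCι0, hCι⟩ := exists_norm_iteratedDeriv_le_on_Icc (g := sectorInvCutoff (e₀ ^ 2 / 128))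
    (fun m => contDiff_sectorInvCutoff hq₀) N 0 (M₁ ^ 2)
  refine ⟨2 ^ N * M₁ * (N ! * Cι * D ^ N), by positivity, fun b σ hb hMb i hi => ?_⟩
  have hMb' : ∀ j ≤ N, ‖iteratedDeriv j b σ‖ ≤ M₁ := fun j hj => (hMb j hj).trans hMM
  have hub : ContDiff ℝ N fun σ => ‖b σ‖ ^ 2 := hb.norm_sq ℝ
  have hb0 : ‖b σ‖ ≤ M₁ := by have := hMb' 0 (Nat.zero_le _); rwa [iteratedDeriv_zero] at this
  have hvb : ‖b σ‖ ^ 2 ∈ Icc (0 : ℝ) (M₁ ^ 2) := ⟨by positivity, pow_le_pow_left₀ (norm_nonneg _) hb0 2⟩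
  -- the factor `η(|b|²)`: Faà di Bruno, all orders `j ≤ i`
  have hη : ∀ j ≤ i, ‖iteratedDeriv j (fun σ => ((sectorInvCutoff (e₀ ^ 2 / 128) (‖b σ‖ ^ 2) : ℝ) : ℂ)) σ‖ ≤
      (N ! * Cι * D ^ N) * 1 ^ j := by
    intro j hj
    have hjN : j ≤ N := hj.trans hi
    have hDb : ∀ l, 1 ≤ l → l ≤ j → ‖iteratedDeriv l (fun σ => ‖b σ‖ ^ 2) σ‖ ≤ D ^ l := by
      intro l hl1 hl
      have h := norm_iteratedDeriv_norm_sq_le hb σ hMb' (hl.trans hjN)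
      have h2 : (2 : ℝ) ^ (l + 1) ≤ 2 ^ (N + 1) := pow_le_pow_right₀ (by norm_num) (by omega)
      calc _ ≤ 2 ^ (l + 1) * M₁ ^ 2 := h
        _ ≤ D := by rw [hD]; gcongr
        _ ≤ D ^ l := le_self_pow₀ hD1 (by omega)
    have hcomp := norm_iteratedDeriv_comp_le_of_contDiffOn isOpen_univ (mem_univ σ)
      (contDiff_sectorInvCutoff hq₀ (n := j)) (hub.of_le (by exact_mod_cast hjN)).contDiffOn
      (fun l hl => hCι l (hl.trans hjN) _ hvb) hDb
    have hreal : ContDiff ℝ j fun σ => sectorInvCutoff (e₀ ^ 2 / 128) (‖b σ‖ ^ 2) :=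
      (contDiff_sectorInvCutoff hq₀).comp (hub.of_le (by exact_mod_cast hjN))
    rw [iteratedDeriv_ofReal_eq hreal le_rfl, Complex.norm_real, one_pow, mul_one]
    have hfac : (j ! : ℝ) ≤ N ! := by exact_mod_cast Nat.factorial_le hjN
    calc _ ≤ (j ! : ℝ) * Cι * D ^ j := hcomp
      _ ≤ N ! * Cι * D ^ N := by gcongr
  -- the factor `conj b`
  have hconj : ∀ j ≤ i, ‖iteratedDeriv j (fun σ => conj (b σ)) σ‖ ≤ M₁ * 1 ^ j := fun j hj => by
    rw [iteratedDeriv_conj_eq hb (hj.trans hi), Complex.norm_conj, one_pow, mul_one]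
    exact hMb' j (hj.trans hi)
  have hcd1 : ContDiff ℝ i fun σ => conj (b σ) :=
    (Complex.conjCLE.contDiff.comp hb).of_le (by exact_mod_cast hi)
  have hcd2 : ContDiff ℝ i fun σ => ((sectorInvCutoff (e₀ ^ 2 / 128) (‖b σ‖ ^ 2) : ℝ) : ℂ) :=
    (Complex.ofRealCLM.contDiff.comp ((contDiff_sectorInvCutoff hq₀).comp hub)).of_le (by exact_mod_cast hi)
  have h := norm_iteratedDeriv_mul_le_of_geometric hcd1 hcd2 σ zero_le_one hconj hη
  have h2i : (2 : ℝ) ^ i ≤ 2 ^ N := pow_le_pow_right₀ (by norm_num) hi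
  unfold bgmInvSurrogate
  calc _ ≤ 2 ^ i * M₁ * (N ! * Cι * D ^ N) * 1 ^ i := h
    _ ≤ 2 ^ N * M₁ * (N ! * Cι * D ^ N) := by rw [one_pow, mul_one]; gcongr


/-- **The core estimate (all orders, one line).** For every `N`, `M`, `Z` there is `K ≥ 0` (depending on
`N, e₀, M, Z` only) such that for smooth complex curves `a, b` (the rescaled denominators `γ^{-h}D_h`,
`γ^{-h}D_{h-1}` along a line) and a smooth real factor `z` (the angular cutoff along the line) with all
derivatives of order `≤ N` at `σ` bounded by `M`, `M`, `Z` respectively, every derivative of order `≤ N`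
at `σ` of `σ ↦ [shellSurrogate(a, b) · z] · invSurrogate(b)` is bounded by `K` — the content of BGM's
"dimensional bound for the integrand plus `N` derivatives each costing `γ^{-h}`" once the line is
rescaled by `γ^h`. [cite: BenfattoGiulianiMastropietro2006, §2.5 proof of Lemma 2.2 (2.53)–(2.56) p0011:L7–L33] -/
theorem exists_norm_iteratedDeriv_surrogateProduct_le {e₀ : ℝ} (he : 0 < e₀) (N : ℕ) (M Z : ℝ) :
    ∃ K : ℝ, 0 ≤ K ∧ ∀ (a b : ℝ → ℂ) (z : ℝ → ℝ) (σ : ℝ), ContDiff ℝ N a → ContDiff ℝ N b → ContDiff ℝ N z →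
      (∀ j ≤ N, ‖iteratedDeriv j a σ‖ ≤ M) → (∀ j ≤ N, ‖iteratedDeriv j b σ‖ ≤ M) →
      (∀ j ≤ N, ‖iteratedDeriv j z σ‖ ≤ Z) →
      ∀ i ≤ N, ‖iteratedDeriv i (fun σ => ((bgmShellSurrogate e₀ (a σ) (b σ) * z σ : ℝ) : ℂ) *
        bgmInvSurrogate e₀ (b σ)) σ‖ ≤ K := by
  obtain ⟨K₁, hK₁0, hK₁⟩ := exists_norm_iteratedDeriv_shellSurrogate_le he N M
  obtain ⟨K₂, hK₂0, hK₂⟩ := exists_norm_iteratedDeriv_invSurrogate_le he N M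
  set Z₁ : ℝ := max Z 0 with hZ₁
  refine ⟨2 ^ N * (2 ^ N * K₁ * Z₁) * K₂, by positivity, fun a b z σ ha hb hz hMa hMb hZ i hi => ?_⟩
  have hS : ContDiff ℝ N fun σ => bgmShellSurrogate e₀ (a σ) (b σ) := contDiff_bgmShellSurrogate_comp he ha hb
  have hSi : ContDiff ℝ i fun σ => bgmShellSurrogate e₀ (a σ) (b σ) := hS.of_le (by exact_mod_cast hi)
  have hzi : ContDiff ℝ i z := hz.of_le (by exact_mod_cast hi)
  -- the real product `S · z`
  have hSz : ∀ j ≤ i, ‖iteratedDeriv j (fun σ => bgmShellSurrogate e₀ (a σ) (b σ) * z σ) σ‖ ≤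
      (2 ^ N * K₁ * Z₁) * 1 ^ j := by
    intro j hj
    have h := norm_iteratedDeriv_mul_le_of_geometric (hSi.of_le (by exact_mod_cast hj))
      (hzi.of_le (by exact_mod_cast hj)) σ zero_le_one
      (fun l hl => by rw [one_pow, mul_one]; exact hK₁ a b σ ha hb hMa hMb l (hl.trans (hj.trans hi)))
      (fun l hl => by rw [one_pow, mul_one]; exact (hZ l (hl.trans (hj.trans hi))).trans (le_max_left Z 0))
    have h2 : (2 : ℝ) ^ j ≤ 2 ^ N := pow_le_pow_right₀ (by norm_num) (hj.trans hi)
    calc _ ≤ 2 ^ j * K₁ * Z₁ * 1 ^ j := h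
      _ ≤ (2 ^ N * K₁ * Z₁) * 1 ^ j := by rw [one_pow, mul_one, mul_one]; gcongr
  have hSzC : ∀ j ≤ i, ‖iteratedDeriv j (fun σ => ((bgmShellSurrogate e₀ (a σ) (b σ) * z σ : ℝ) : ℂ)) σ‖ ≤
      (2 ^ N * K₁ * Z₁) * 1 ^ j := fun j hj => by
    rw [iteratedDeriv_ofReal_eq (hSi.mul hzi) hj, Complex.norm_real]; exact hSz j hj
  have hinv : ∀ j ≤ i, ‖iteratedDeriv j (fun σ => bgmInvSurrogate e₀ (b σ)) σ‖ ≤ K₂ * 1 ^ j := fun j hj => by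
    rw [one_pow, mul_one]; exact hK₂ b σ hb hMb j (hj.trans hi)
  have hcd1 : ContDiff ℝ i fun σ => ((bgmShellSurrogate e₀ (a σ) (b σ) * z σ : ℝ) : ℂ) :=
    Complex.ofRealCLM.contDiff.comp (hSi.mul hzi)
  have hcd2 : ContDiff ℝ i fun σ => bgmInvSurrogate e₀ (b σ) :=
    (contDiff_bgmInvSurrogate_comp he hb).of_le (by exact_mod_cast hi)
  have h := norm_iteratedDeriv_mul_le_of_geometric hcd1 hcd2 σ zero_le_one hSzC hinv
  have h2i : (2 : ℝ) ^ i ≤ 2 ^ N := pow_le_pow_right₀ (by norm_num) hi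
  calc _ ≤ 2 ^ i * (2 ^ N * K₁ * Z₁) * K₂ * 1 ^ i := h
    _ ≤ 2 ^ N * (2 ^ N * K₁ * Z₁) * K₂ := by rw [one_pow, mul_one]; gcongr

/-! ### §4 The moving dispersion along spatial lines: (2.36) telescoped, all orders -/

/-- **Multilinear forms on `ℝᵈ` (sup norm) on a repeated vector**: `‖A(w, …, w)‖ ≤ ‖w‖ⁿ Σ_I ‖A(e_I)‖`,
the sum over coordinate multi-indices. [folklore] -/
private theorem norm_apply_const_le_pow_mul_sum {d n : ℕ} {F : Type*} [NormedAddCommGroup F] [NormedSpace ℝ F]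
    (A : ContinuousMultilinearMap ℝ (fun _ : Fin n => Fin d → ℝ) F) (w : Fin d → ℝ) :
    ‖A (fun _ => w)‖ ≤ ‖w‖ ^ n * ∑ I : Fin n → Fin d, ‖A (fun k => Pi.single (I k) 1)‖ := by
  classical
  have hw : (fun _ : Fin n => w) = fun _ => ∑ i : Fin d, w i • (Pi.single i (1 : ℝ) : Fin d → ℝ) := by
    funext k; ext j
    simp [Finset.sum_apply, Pi.single_apply]
  rw [hw, ContinuousMultilinearMap.map_sum A (fun _ i => w i • (Pi.single i (1 : ℝ) : Fin d → ℝ))]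
  calc ‖∑ I : Fin n → Fin d, A (fun k => w (I k) • (Pi.single (I k) (1 : ℝ) : Fin d → ℝ))‖
      ≤ ∑ I : Fin n → Fin d, ‖A (fun k => w (I k) • (Pi.single (I k) (1 : ℝ) : Fin d → ℝ))‖ := norm_sum_le _ _
    _ ≤ ∑ I : Fin n → Fin d, ‖w‖ ^ n * ‖A (fun k => Pi.single (I k) 1)‖ := by
        refine Finset.sum_le_sum fun I _ => ?_
        rw [ContinuousMultilinearMap.map_smul_univ, norm_smul, Real.norm_eq_abs, Finset.abs_prod]
        refine mul_le_mul_of_nonneg_right ?_ (norm_nonneg _)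
        calc ∏ k, |w (I k)| ≤ ∏ _k : Fin n, ‖w‖ :=
              Finset.prod_le_prod (fun k _ => abs_nonneg _) fun k _ => by
                rw [← Real.norm_eq_abs]; exact norm_le_pi_norm w (I k)
          _ = ‖w‖ ^ n := by rw [Finset.prod_const, Finset.card_univ, Fintype.card_fin]
    _ = ‖w‖ ^ n * ∑ I : Fin n → Fin d, ‖A (fun k => Pi.single (I k) 1)‖ := by rw [Finset.mul_sum]

section Standing

variable {μ e₀ β U c₀ : ℝ} {C : ℕ → ℝ} {hβ : ℤ} {E : ℤ → ℝ × (Fin 2 → ℝ) → ℂ} {h : ℤ}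

/-- `bgmTimeDiffIter β 0 f = f`. [folklore] -/
private theorem bgmTimeDiffIter_zero' (β : ℝ) (f : ℝ × (Fin 2 → ℝ) → ℂ) : bgmTimeDiffIter β 0 f = f := rfl

/-- `Σ_{m<n} m 4^{-m} ≤ 2`. [folklore] -/
private theorem sum_mul_four_zpow_neg_le (n : ℕ) : ∑ m ∈ Finset.range n, (m : ℝ) * (4 : ℝ) ^ (-(m : ℤ)) ≤ 2 := by
  have hterm : ∀ m : ℕ, (m : ℝ) * (4 : ℝ) ^ (-(m : ℤ)) ≤ (1 / 2 : ℝ) ^ m := by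
    intro m
    have h4 : (0 : ℝ) < 4 ^ m := by positivity
    have h2 : (0 : ℝ) < 2 ^ m := by positivity
    rw [zpow_neg, zpow_natCast, one_div, inv_pow, mul_inv_le_iff₀ h4]
    have h42 : (2 ^ m)⁻¹ * (4 : ℝ) ^ m = 2 ^ m := by
      rw [show (4 : ℝ) ^ m = 2 ^ m * 2 ^ m by rw [← mul_pow]; norm_num, ← mul_assoc,
        inv_mul_cancel₀ h2.ne', one_mul]
    rw [h42]
    exact_mod_cast (Nat.lt_two_pow_self (n := m)).le
  calc ∑ m ∈ Finset.range n, (m : ℝ) * (4 : ℝ) ^ (-(m : ℤ)) ≤ ∑ m ∈ Finset.range n, (1 / 2 : ℝ) ^ m :=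
        Finset.sum_le_sum fun m _ => hterm m
    _ ≤ 2 := sum_geometric_two_le n

/-- `Σ_{m<n} m x^{(i-2)m} ≤ n² x^{(i-2)n}` for `x ≥ 1`, `i ≥ 2`. [folklore] -/
private theorem sum_mul_zpow_le_sq_mul (n : ℕ) {i : ℕ} (hi : 2 ≤ i) :
    ∑ m ∈ Finset.range n, (m : ℝ) * (4 : ℝ) ^ (((i : ℤ) - 2) * (m : ℤ)) ≤
      (n : ℝ) ^ 2 * (4 : ℝ) ^ (((i : ℤ) - 2) * (n : ℤ)) := by
  have hterm : ∀ m ∈ Finset.range n, (m : ℝ) * (4 : ℝ) ^ (((i : ℤ) - 2) * (m : ℤ)) ≤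
      (n : ℝ) * (4 : ℝ) ^ (((i : ℤ) - 2) * (n : ℤ)) := by
    intro m hm
    have hmn : m ≤ n := (Finset.mem_range.1 hm).le
    refine mul_le_mul (by exact_mod_cast hmn) (zpow_le_zpow_right₀ (by norm_num) ?_) (by positivity) (by positivity)
    have : (0 : ℤ) ≤ (i : ℤ) - 2 := by omega
    exact mul_le_mul_of_nonneg_left (by exact_mod_cast hmn) this
  calc _ ≤ ∑ _m ∈ Finset.range n, (n : ℝ) * (4 : ℝ) ^ (((i : ℤ) - 2) * (n : ℤ)) := Finset.sum_le_sum hterm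
    _ = (n : ℝ) ^ 2 * (4 : ℝ) ^ (((i : ℤ) - 2) * (n : ℤ)) := by
        rw [Finset.sum_const, Finset.card_range, nsmul_eq_mul]; ring

/-- **One increment of (2.36) on a repeated spatial vector**: for `h_β ≤ -m`, `k₀ ∈ D_β`, `i ≥ 1`,
`‖Dⁱ(E_{-m} - E_{-m-1})(k₀, ·)(k⃗)(w, …, w)‖ ≤ ‖w‖ⁱ 2ⁱ |C_i| U² m γ^{(i-2)m}` (the `2ⁱ` mixed partials).
[cite: BenfattoGiulianiMastropietro2006, §2.3 (2.36) p0008:L46] -/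
theorem norm_iteratedFDeriv_increment_apply_le (hS : BGMSmoothness β U C hβ E) {m : ℕ} (hm : hβ ≤ -(m : ℤ))
    {k₀ : ℝ} (hk₀ : k₀ ∈ matsubaraSet β) {i : ℕ} (hi : 1 ≤ i) (k w : Fin 2 → ℝ) :
    ‖iteratedFDeriv ℝ i (fun k' => E (-(m : ℤ)) (k₀, k') - E (-(m : ℤ) - 1) (k₀, k')) k (fun _ => w)‖ ≤
      ‖w‖ ^ i * (2 ^ i * (|C i| * U ^ 2 * ((m : ℝ) * (4 : ℝ) ^ (((i : ℤ) - 2) * (m : ℤ))))) := by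
  have hbd := (hS.2.2 (-(m : ℤ)) hm (by omega)).2 0 i (by omega)
  have hcast : |(((-(m : ℤ)) : ℤ) : ℝ)| = m := by push_cast; rw [abs_neg, Nat.abs_cast]
  have hexp : ((2 : ℤ) - (i : ℤ)) * (-(m : ℤ)) = ((i : ℤ) - 2) * (m : ℤ) := by ring
  have hI : ∀ I : Fin i → Fin 2,
      ‖iteratedFDeriv ℝ i (fun k' => E (-(m : ℤ)) (k₀, k') - E (-(m : ℤ) - 1) (k₀, k')) k
        (fun j => Pi.single (I j) 1)‖ ≤ |C i| * U ^ 2 * ((m : ℝ) * (4 : ℝ) ^ (((i : ℤ) - 2) * (m : ℤ))) := by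
    intro I
    have h := hbd I k₀ hk₀ k
    simp only [mixedPartial, bgmTimeDiffIter_zero', hcast, zero_add] at h
    rw [hexp] at h
    calc _ ≤ C i * |U| ^ 2 * m * (4 : ℝ) ^ (((i : ℤ) - 2) * (m : ℤ)) := h
      _ = C i * (U ^ 2 * ((m : ℝ) * (4 : ℝ) ^ (((i : ℤ) - 2) * (m : ℤ)))) := by rw [sq_abs]; ring
      _ ≤ |C i| * (U ^ 2 * ((m : ℝ) * (4 : ℝ) ^ (((i : ℤ) - 2) * (m : ℤ)))) :=
          mul_le_mul_of_nonneg_right (le_abs_self _) (by positivity)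
      _ = _ := by ring
  refine (norm_apply_const_le_pow_mul_sum _ w).trans (mul_le_mul_of_nonneg_left ?_ (by positivity))
  calc _ ≤ ∑ _I : Fin i → Fin 2, |C i| * U ^ 2 * ((m : ℝ) * (4 : ℝ) ^ (((i : ℤ) - 2) * (m : ℤ))) :=
        Finset.sum_le_sum fun I _ => hI I
    _ = _ := by rw [Finset.sum_const, Finset.card_univ, Fintype.card_fun, Fintype.card_fin, Fintype.card_fin,
        nsmul_eq_mul, Nat.cast_pow, Nat.cast_ofNat]

/-- **All spatial line derivatives of the moving dispersion** (2.36 telescoped from `E_0 = ε₀`): for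
`h_β - 1 ≤ h' ≤ 0`, `n' = -h'`, a Matsubara `k₀` and `i ≥ 1`,
`‖∂ₛⁱ E_{h'}(k₀, q⃗ + s w⃗)‖ ≤ 4‖w⃗‖ⁱ + ‖w⃗‖ⁱ 2ⁱ |C_i| T_i`, `T_1 = 2U²`, `T_i = U² n'² γ^{(i-2)n'}` (`i ≥ 2`)
(the free band contributes `2|w₁|ⁱ + 2|w₂|ⁱ`). [cite: BenfattoGiulianiMastropietro2006, §2.4 (2.41a)–(2.42) p0009:L77–L101] -/
theorem norm_iteratedDeriv_dispersion_line_le (hI : BGMInitial E) (hS : BGMSmoothness β U C hβ E) {h' : ℤ}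
    (hh₁ : hβ - 1 ≤ h') (hh₀ : h' ≤ 0) {k₀ : ℝ} (hk₀ : k₀ ∈ matsubaraSet β) (q w : Fin 2 → ℝ) (s : ℝ)
    {i : ℕ} (hi : 1 ≤ i) :
    ‖iteratedDeriv i (fun s : ℝ => E h' (k₀, q + s • w)) s‖ ≤
      4 * ‖w‖ ^ i + ‖w‖ ^ i * (2 ^ i * (|C i| * U ^ 2 *
        (if i = 1 then 2 else ((-h' : ℤ) : ℝ) ^ 2 * (4 : ℝ) ^ (((i : ℤ) - 2) * (-h'))))) := by
  set n := (-h').toNat with hn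
  have hnz : ((n : ℕ) : ℤ) = -h' := Int.toNat_of_nonneg (by omega)
  have hmem : ∀ m ∈ Finset.range n, hβ ≤ -(m : ℤ) := fun m hm => by
    have := Finset.mem_range.1 hm; omega
  set g : ℕ → (Fin 2 → ℝ) → ℂ := fun m k => E (-(m : ℤ)) (k₀, k) - E (-(m : ℤ) - 1) (k₀, k) with hg
  have hslice : ∀ (j : ℤ) (l : ℕ), ContDiff ℝ l (fun k : Fin 2 → ℝ => E j (k₀, k)) := fun j l => hS.1 j k₀ l
  have hgd : ∀ m (l : ℕ), ContDiff ℝ l (g m) := fun m l => (hslice _ l).sub (hslice _ l)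
  -- `E_{h'}(k₀, ·) = ε₀ - Σ g_m`
  have hE : (fun k : Fin 2 → ℝ => E h' (k₀, k)) =
      fun k => ((sqDispersion k : ℝ) : ℂ) - ∑ m ∈ Finset.range n, g m k := by
    funext k; rw [bgm_telescope E hh₀ (k₀, k), hI]
  -- the line restrictions
  have hline : (fun s : ℝ => E h' (k₀, q + s • w)) =
      (fun s : ℝ => ((sqDispersion (q + s • w) : ℝ) : ℂ)) - fun s => ∑ m ∈ Finset.range n, g m (q + s • w) := by
    funext s; have := congrFun hE (q + s • w); simpa using this
  have hεline : ContDiff ℝ i fun s : ℝ => ((sqDispersion (q + s • w) : ℝ) : ℂ) :=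
    Complex.ofRealCLM.contDiff.comp (contDiff_lineRestriction (contDiff_sqDispersion (m := i)) q w)
  have hgline : ∀ m, ContDiff ℝ i fun s : ℝ => g m (q + s • w) := fun m => contDiff_lineRestriction (hgd m i) q w
  have hsumline : ContDiff ℝ i fun s : ℝ => ∑ m ∈ Finset.range n, g m (q + s • w) :=
    ContDiff.sum fun m _ => hgline m
  rw [hline, iteratedDeriv_sub hεline.contDiffAt hsumline.contDiffAt]
  -- the free band
  have hε : ‖iteratedDeriv i (fun s : ℝ => ((sqDispersion (q + s • w) : ℝ) : ℂ)) s‖ ≤ 4 * ‖w‖ ^ i := by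
    rw [iteratedDeriv_ofReal_eq (contDiff_lineRestriction (contDiff_sqDispersion (m := i)) q w) le_rfl,
      Complex.norm_real, Real.norm_eq_abs]
    have hfun : (fun s : ℝ => sqDispersion (q + s • w)) =
        fun s => (0 : ℝ) + (-2 * Real.cos (q 0 + s * w 0) + -2 * Real.cos (q 1 + s * w 1) + -(0 : ℝ)) := by
      funext s; have := sqDispersion_add_smul_sub 0 q w s; linarith
    rw [hfun, iteratedDeriv_const_add hi]
    have hw0 : |w 0| ≤ ‖w‖ := by rw [← Real.norm_eq_abs]; exact norm_le_pi_norm w 0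
    have hw1 : |w 1| ≤ ‖w‖ := by rw [← Real.norm_eq_abs]; exact norm_le_pi_norm w 1
    calc _ ≤ 2 * |w 0| ^ i + 2 * |w 1| ^ i := abs_iteratedDeriv_lineDispersion_le 0 q w s hi
      _ ≤ 2 * ‖w‖ ^ i + 2 * ‖w‖ ^ i := by gcongr
      _ = 4 * ‖w‖ ^ i := by ring
  -- the increments
  have hgm : ∀ m ∈ Finset.range n, ‖iteratedDeriv i (fun s : ℝ => g m (q + s • w)) s‖ ≤
      ‖w‖ ^ i * (2 ^ i * (|C i| * U ^ 2 * ((m : ℝ) * (4 : ℝ) ^ (((i : ℤ) - 2) * (m : ℤ))))) := by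
    intro m hm
    rw [iteratedDeriv_lineRestriction (hgd m i) q w s]
    exact norm_iteratedFDeriv_increment_apply_le hS (hmem m hm) hk₀ hi _ w
  have hsum : ‖iteratedDeriv i (fun s : ℝ => ∑ m ∈ Finset.range n, g m (q + s • w)) s‖ ≤
      ‖w‖ ^ i * (2 ^ i * (|C i| * U ^ 2 * ∑ m ∈ Finset.range n, (m : ℝ) * (4 : ℝ) ^ (((i : ℤ) - 2) * (m : ℤ)))) := by
    rw [iteratedDeriv_fun_sum fun m _ => (hgline m).contDiffAt]
    refine (norm_sum_le _ _).trans ?_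
    rw [Finset.mul_sum, Finset.mul_sum, Finset.mul_sum]
    exact Finset.sum_le_sum hgm
  -- the scale sums
  have hT : |C i| * U ^ 2 * ∑ m ∈ Finset.range n, (m : ℝ) * (4 : ℝ) ^ (((i : ℤ) - 2) * (m : ℤ)) ≤
      |C i| * U ^ 2 * (if i = 1 then 2 else ((-h' : ℤ) : ℝ) ^ 2 * (4 : ℝ) ^ (((i : ℤ) - 2) * (-h'))) := by
    refine mul_le_mul_of_nonneg_left ?_ (by positivity)
    split_ifs with h1
    · subst h1
      simpa using sum_mul_four_zpow_neg_le n
    · have h2 : 2 ≤ i := by omega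
      have hnr : (n : ℝ) = ((-h' : ℤ) : ℝ) := by exact_mod_cast hnz
      have := sum_mul_zpow_le_sq_mul n h2
      rwa [hnz, hnr] at this
  calc _ ≤ ‖iteratedDeriv i (fun s : ℝ => ((sqDispersion (q + s • w) : ℝ) : ℂ)) s‖ +
        ‖iteratedDeriv i (fun s : ℝ => ∑ m ∈ Finset.range n, g m (q + s • w)) s‖ := norm_sub_le _ _
    _ ≤ 4 * ‖w‖ ^ i + ‖w‖ ^ i * (2 ^ i * (|C i| * U ^ 2 *
        ∑ m ∈ Finset.range n, (m : ℝ) * (4 : ℝ) ^ (((i : ℤ) - 2) * (m : ℤ)))) := add_le_add hε hsum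
    _ ≤ _ := by gcongr


/-- **The rescaled spatial line**: for `h_β ≤ h ≤ 0`, `h' ∈ {h-1, h}`, `‖v‖ ≤ 1` and `1 ≤ i ≤ N`,
`γ^{-h} ‖∂_σⁱ E_{h'}(k₀, q⃗ + σ γ^h v)‖ ≤ 4 + 2^{N+2} 4^N |C_i| c₀²` — every derivative of the rescaled
denominators along the rescaled line is `O(1)`, uniformly in the scale ((2.41a)/(2.42) with
`|U||h_β| ≤ c₀`). [cite: BenfattoGiulianiMastropietro2006, §2.5 proof of Lemma 2.2 (2.53)–(2.55) p0011:L7–L20] -/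
theorem norm_iteratedDeriv_rescaled_dispersion_line_le (hI : BGMInitial E) (hS : BGMSmoothness β U C hβ E)
    (hh₁ : hβ ≤ h) (hh₀ : h ≤ 0) {h' : ℤ} (hh'₁ : h - 1 ≤ h') (hh'₀ : h' ≤ h) (hU : |U| ≤ c₀)
    (hUh : |U| * |(hβ : ℝ)| ≤ c₀) {k₀ : ℝ} (hk₀ : k₀ ∈ matsubaraSet β) (q v : Fin 2 → ℝ) (hv : ‖v‖ ≤ 1)
    (σ : ℝ) {i N : ℕ} (hi : 1 ≤ i) (hiN : i ≤ N) :
    (4 : ℝ) ^ (-h) * ‖iteratedDeriv i (fun s : ℝ => E h' (k₀, q + s • ((4 : ℝ) ^ h • v))) σ‖ ≤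
      4 + 2 ^ (N + 2) * 4 ^ N * |C i| * c₀ ^ 2 := by
  have hc₀ : 0 ≤ c₀ := (abs_nonneg U).trans hU
  have h4h : (0 : ℝ) < (4 : ℝ) ^ h := zpow_pos (by norm_num) _
  have h4n : (0 : ℝ) < (4 : ℝ) ^ (-h) := zpow_pos (by norm_num) _
  have h4h1 : (4 : ℝ) ^ h ≤ 1 := zpow_le_one_of_nonpos₀ (by norm_num) hh₀
  set w : Fin 2 → ℝ := (4 : ℝ) ^ h • v with hw
  have hwn : ‖w‖ ≤ (4 : ℝ) ^ h := by
    rw [hw, norm_smul, Real.norm_of_nonneg h4h.le]; exact mul_le_of_le_one_right h4h.le hv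
  have hw0 : 0 ≤ ‖w‖ := norm_nonneg _
  have hline := norm_iteratedDeriv_dispersion_line_le hI hS (h' := h') (by omega) (by omega) hk₀ q w σ hi
  -- `4^{-h} ‖w‖^i ≤ 4^{h(i-1)} ≤ 1`
  have hpw : ‖w‖ ^ i ≤ ((4 : ℝ) ^ h) ^ i := pow_le_pow_left₀ hw0 hwn i
  have hzi : ((4 : ℝ) ^ h) ^ i = (4 : ℝ) ^ (h * i) := by rw [← zpow_natCast, ← zpow_mul]
  have hkey : (4 : ℝ) ^ (-h) * ‖w‖ ^ i ≤ (4 : ℝ) ^ (h * ((i : ℤ) - 1)) := by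
    calc (4 : ℝ) ^ (-h) * ‖w‖ ^ i ≤ (4 : ℝ) ^ (-h) * ((4 : ℝ) ^ h) ^ i :=
          mul_le_mul_of_nonneg_left hpw h4n.le
      _ = (4 : ℝ) ^ (h * ((i : ℤ) - 1)) := by
          rw [hzi, ← zpow_add₀ (by norm_num : (4 : ℝ) ≠ 0)]; congr 1; ring
  have hle1 : (4 : ℝ) ^ (h * ((i : ℤ) - 1)) ≤ 1 :=
    zpow_le_one_of_nonpos₀ (by norm_num) (mul_nonpos_of_nonpos_of_nonneg hh₀ (by omega))
  -- the first term
  have hA : (4 : ℝ) ^ (-h) * (4 * ‖w‖ ^ i) ≤ 4 := by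
    calc (4 : ℝ) ^ (-h) * (4 * ‖w‖ ^ i) = 4 * ((4 : ℝ) ^ (-h) * ‖w‖ ^ i) := by ring
      _ ≤ 4 * 1 := by gcongr; exact hkey.trans hle1
      _ = 4 := by ring
  -- the second term
  have hU2 : |U| * ((-h' : ℤ) : ℝ) ≤ 2 * c₀ := by
    have h1 : ((-h' : ℤ) : ℝ) ≤ |(hβ : ℝ)| + 1 := by
      rw [abs_of_nonpos (by exact_mod_cast (hh₁.trans hh₀))]
      have : ((-h' : ℤ) : ℝ) ≤ -(hβ : ℝ) + 1 := by exact_mod_cast (show -h' ≤ -hβ + 1 by omega)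
      linarith
    calc |U| * ((-h' : ℤ) : ℝ) ≤ |U| * (|(hβ : ℝ)| + 1) := mul_le_mul_of_nonneg_left h1 (abs_nonneg U)
      _ = |U| * |(hβ : ℝ)| + |U| := by ring
      _ ≤ c₀ + c₀ := add_le_add hUh hU
      _ = 2 * c₀ := by ring
  have hB : (4 : ℝ) ^ (-h) * (‖w‖ ^ i * (2 ^ i * (|C i| * U ^ 2 *
      (if i = 1 then 2 else ((-h' : ℤ) : ℝ) ^ 2 * (4 : ℝ) ^ (((i : ℤ) - 2) * (-h')))))) ≤
      2 ^ (N + 2) * 4 ^ N * |C i| * c₀ ^ 2 := by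
    have hUc : U ^ 2 ≤ c₀ ^ 2 := by rw [← sq_abs]; exact pow_le_pow_left₀ (abs_nonneg U) hU 2
    have h2i : (2 : ℝ) ^ i ≤ 2 ^ N := pow_le_pow_right₀ (by norm_num) hiN
    have h4N : (1 : ℝ) ≤ 4 ^ N := one_le_pow₀ (by norm_num)
    split_ifs with h1
    · -- `i = 1`: `4^{-h}‖w‖ 2 |C 1| U² 2 ≤ 4|C 1| c₀²`
      calc (4 : ℝ) ^ (-h) * (‖w‖ ^ i * (2 ^ i * (|C i| * U ^ 2 * 2)))
          = ((4 : ℝ) ^ (-h) * ‖w‖ ^ i) * (2 ^ i * 2) * |C i| * U ^ 2 := by ring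
        _ ≤ 1 * (2 ^ N * 2) * |C i| * c₀ ^ 2 := by gcongr; exact hkey.trans hle1
        _ ≤ 2 ^ (N + 2) * 4 ^ N * |C i| * c₀ ^ 2 := by
            have : (0 : ℝ) ≤ |C i| * c₀ ^ 2 := by positivity
            have h22 : (1 : ℝ) * (2 ^ N * 2) ≤ 2 ^ (N + 2) * 4 ^ N := by
              rw [pow_add]; nlinarith [pow_nonneg (by norm_num : (0 : ℝ) ≤ 2) N]
            nlinarith
    · -- `i ≥ 2`: `4^{h(i-1)} (-h')² 4^{(i-2)(-h')} U² ≤ 4^{i-2} (2c₀)²`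
      have h2 : 2 ≤ i := by omega
      have hexp : (4 : ℝ) ^ (h * ((i : ℤ) - 1)) * (4 : ℝ) ^ (((i : ℤ) - 2) * (-h')) ≤ 4 ^ N := by
        rw [← zpow_add₀ (by norm_num : (4 : ℝ) ≠ 0), ← zpow_natCast]
        refine zpow_le_zpow_right₀ (by norm_num) ?_
        have : h * ((i : ℤ) - 1) + ((i : ℤ) - 2) * (-h') = h + ((i : ℤ) - 2) * (h - h') := by ring
        rw [this]
        nlinarith [show (i : ℤ) - 2 ≤ N by omega, show (0 : ℤ) ≤ (i : ℤ) - 2 by omega,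
          show h - h' ≤ 1 by omega]
      have hn'0 : (0 : ℝ) ≤ ((-h' : ℤ) : ℝ) := by exact_mod_cast (show (0 : ℤ) ≤ -h' by omega)
      have hsq : ((-h' : ℤ) : ℝ) ^ 2 * U ^ 2 ≤ (2 * c₀) ^ 2 := by
        have h1 : ((-h' : ℤ) : ℝ) ^ 2 * U ^ 2 = (|U| * ((-h' : ℤ) : ℝ)) ^ 2 := by rw [mul_pow, sq_abs]; ring
        rw [h1]
        exact pow_le_pow_left₀ (mul_nonneg (abs_nonneg U) hn'0) hU2 2
      calc (4 : ℝ) ^ (-h) * (‖w‖ ^ i * (2 ^ i * (|C i| * U ^ 2 *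
            (((-h' : ℤ) : ℝ) ^ 2 * (4 : ℝ) ^ (((i : ℤ) - 2) * (-h'))))))
          = ((4 : ℝ) ^ (-h) * ‖w‖ ^ i) * (4 : ℝ) ^ (((i : ℤ) - 2) * (-h')) * 2 ^ i * |C i| *
              (((-h' : ℤ) : ℝ) ^ 2 * U ^ 2) := by ring
        _ ≤ (4 : ℝ) ^ (h * ((i : ℤ) - 1)) * (4 : ℝ) ^ (((i : ℤ) - 2) * (-h')) * 2 ^ N * |C i| *
              (2 * c₀) ^ 2 := by gcongr
        _ ≤ 4 ^ N * 2 ^ N * |C i| * (2 * c₀) ^ 2 := by gcongr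
        _ = 2 ^ (N + 2) * 4 ^ N * |C i| * c₀ ^ 2 := by ring
  calc _ ≤ (4 : ℝ) ^ (-h) * (4 * ‖w‖ ^ i + ‖w‖ ^ i * (2 ^ i * (|C i| * U ^ 2 *
        (if i = 1 then 2 else ((-h' : ℤ) : ℝ) ^ 2 * (4 : ℝ) ^ (((i : ℤ) - 2) * (-h')))))) :=
        mul_le_mul_of_nonneg_left hline h4n.le
    _ = _ := by rw [mul_add]
    _ ≤ 4 + 2 ^ (N + 2) * 4 ^ N * |C i| * c₀ ^ 2 := add_le_add hA hB

/-- The rescaled denominator `σ ↦ γ^{-h}D_{h'}(k₀, q⃗ + σ γ^h v)` of (2.18) is smooth in the momentum ((2.36), footnote ¹). [cite: BenfattoGiulianiMastropietro2006, §2.3 (2.18), (2.36) p0007:L17, p0008:L46] -/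
theorem contDiff_rescaledDenom_line (hS : BGMSmoothness β U C hβ E) (μ k₀ : ℝ) (h h' : ℤ) (q v : Fin 2 → ℝ)
    {n : ℕ} : ContDiff ℝ n fun σ : ℝ =>
      (((4 : ℝ) ^ (-h) : ℝ) : ℂ) * bgmDenom μ E h' (k₀, q + σ • ((4 : ℝ) ^ h • v)) := by
  have hsl : ContDiff ℝ n fun k : Fin 2 → ℝ => E h' (k₀, k) := hS.1 h' k₀ n
  have hl := contDiff_lineRestriction hsl q ((4 : ℝ) ^ h • v)
  simp only [bgmDenom]
  exact contDiff_const.mul (contDiff_const.add (hl.sub contDiff_const))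

/-- Derivatives of order `≥ 1` of the rescaled denominator (2.18) along the rescaled line are those of
`γ^{-h}E_{h'}` (the `-ik₀ - μ` part is constant in `k⃗`). [cite: BenfattoGiulianiMastropietro2006, §2.3 (2.18) p0007:L17] -/
theorem iteratedDeriv_rescaledDenom_line (hS : BGMSmoothness β U C hβ E) (μ k₀ : ℝ) (h h' : ℤ)
    (q v : Fin 2 → ℝ) {i : ℕ} (hi : 1 ≤ i) (σ : ℝ) :
    iteratedDeriv i (fun σ : ℝ => (((4 : ℝ) ^ (-h) : ℝ) : ℂ) * bgmDenom μ E h' (k₀, q + σ • ((4 : ℝ) ^ h • v))) σ =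
      (((4 : ℝ) ^ (-h) : ℝ) : ℂ) * iteratedDeriv i (fun s : ℝ => E h' (k₀, q + s • ((4 : ℝ) ^ h • v))) σ := by
  have hsl : ContDiff ℝ i fun k : Fin 2 → ℝ => E h' (k₀, k) := hS.1 h' k₀ i
  have hl := contDiff_lineRestriction hsl q ((4 : ℝ) ^ h • v)
  have hfun : (fun σ : ℝ => bgmDenom μ E h' (k₀, q + σ • ((4 : ℝ) ^ h • v))) =
      fun σ => (-(Complex.I * (k₀ : ℂ)) - (μ : ℂ)) + E h' (k₀, q + σ • ((4 : ℝ) ^ h • v)) := by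
    funext σ; simp only [bgmDenom]; ring
  have hD : ContDiff ℝ i fun σ : ℝ => bgmDenom μ E h' (k₀, q + σ • ((4 : ℝ) ^ h • v)) := by
    rw [hfun]; exact contDiff_const.add hl
  rw [iteratedDeriv_const_mul _ hD.contDiffAt, hfun, iteratedDeriv_const_add hi]

/-- On the support of `f_h(k₀, ·)`: `|D_h| ≤ e₀γ^h`, `|D_{h-1}| ≤ 2e₀γ^h`, `|q⃗|² ≥ (μ+4-e₀)/2` — closed
conditions, hence valid on the CLOSURE of the support. [cite: BenfattoGiulianiMastropietro2006, §2.4 (2.42a) p0010:L9–L16] -/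
theorem closure_support_bounds (hI : BGMInitial E) (hS : BGMSmoothness β U C hβ E) (he : 0 < e₀)
    (hh₁ : hβ ≤ h) (hh₀ : h ≤ 0) (hU : |U| ≤ c₀) (hUh : |U| * |(hβ : ℝ)| ≤ c₀) (hK₀ : |C 0| * c₀ ≤ 3 / 16 * e₀)
    (hgap' : 2 * |C 0| * c₀ ≤ (μ + 4 - e₀) / 2) {j : ℤ} {q : Fin 2 → ℝ}
    (hq : q ∈ closure {q | bgmShell e₀ μ E h (fermiMatsubara β j, q) ≠ 0}) :
    ‖bgmDenom μ E h (fermiMatsubara β j, q)‖ ≤ e₀ * (4 : ℝ) ^ h ∧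
    ‖bgmDenom μ E (h - 1) (fermiMatsubara β j, q)‖ ≤ 2 * e₀ * (4 : ℝ) ^ h ∧
    (μ + 4 - e₀) / 2 ≤ q 0 ^ 2 + q 1 ^ 2 := by
  have hk₀ : fermiMatsubara β j ∈ matsubaraSet β := ⟨j, rfl⟩
  have hc : ∀ h'' : ℤ, Continuous fun q : Fin 2 → ℝ => bgmDenom μ E h'' (fermiMatsubara β j, q) := fun h'' => by
    simp only [bgmDenom]
    exact continuous_const.add ((hS.1 h'' _ 0).continuous.sub continuous_const)
  have hclosed : IsClosed {q : Fin 2 → ℝ | ‖bgmDenom μ E h (fermiMatsubara β j, q)‖ ≤ e₀ * (4 : ℝ) ^ h ∧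
      ‖bgmDenom μ E (h - 1) (fermiMatsubara β j, q)‖ ≤ 2 * e₀ * (4 : ℝ) ^ h ∧
      (μ + 4 - e₀) / 2 ≤ q 0 ^ 2 + q 1 ^ 2} := by
    refine (isClosed_le (hc h).norm continuous_const).inter
      ((isClosed_le (hc (h - 1)).norm continuous_const).inter (isClosed_le continuous_const
        (((continuous_apply 0).pow 2).add ((continuous_apply 1).pow 2))))
  have hsub : {q | bgmShell e₀ μ E h (fermiMatsubara β j, q) ≠ 0} ⊆
      {q : Fin 2 → ℝ | ‖bgmDenom μ E h (fermiMatsubara β j, q)‖ ≤ e₀ * (4 : ℝ) ^ h ∧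
      ‖bgmDenom μ E (h - 1) (fermiMatsubara β j, q)‖ ≤ 2 * e₀ * (4 : ℝ) ^ h ∧
      (μ + 4 - e₀) / 2 ≤ q 0 ^ 2 + q 1 ^ 2} := by
    intro q' hf
    have hη := norm_E_sub_E_le_threshold hS hh₁ hh₀ hUh hK₀ hk₀ q'
    refine ⟨(norm_bgmDenom_self_lt_of_bgmShell_ne_zero he hη hf).le,
      (norm_bgmDenom_bounds_of_bgmShell_ne_zero he hη hf).2.le, ?_⟩
    have := lt_sq_add_sq_of_bgmShell_ne_zero (μ := μ) hI hS he hh₁ hh₀ hU hUh hK₀ hf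
    linarith
  exact closure_minimal hsub hclosed hq

/-- The relative angle of `k⃗ ≠ 0` to its own polar angle is `0`. [folklore] -/
private theorem sectorRelAngle_polarAngle_self (k : Fin 2 → ℝ) : sectorRelAngle (polarAngle k) k = 0 := by
  rw [sectorRelAngle, polarAngle]
  have h1 : momToComplex k * Complex.exp (-((Complex.arg (momToComplex k) : ℂ) * Complex.I)) =
      ((‖momToComplex k‖ : ℝ) : ℂ) := by
    have h := Complex.norm_mul_exp_arg_mul_I (momToComplex k)
    calc momToComplex k * Complex.exp (-((Complex.arg (momToComplex k) : ℂ) * Complex.I))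
        = (((‖momToComplex k‖ : ℝ) : ℂ) * Complex.exp ((Complex.arg (momToComplex k) : ℂ) * Complex.I)) *
            Complex.exp (-((Complex.arg (momToComplex k) : ℂ) * Complex.I)) := by rw [h]
      _ = _ := by rw [mul_assoc, ← Complex.exp_add, add_neg_cancel, Complex.exp_zero, mul_one]
  rw [h1, Complex.arg_ofReal_of_nonneg (norm_nonneg _)]

/-- **The surrogate integrand** `Φ̃_{h,m,ω}(k) = [shellSurrogate(γ^{-h}D_h, γ^{-h}D_{h-1}) ·
(radial plateau × ζ_{m,ω}(θ(k⃗)))] · invSurrogate(γ^{-h}D_{h-1})` — the integrand of (2.49) divided by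
`γ^{-h}`, written through the globally smooth surrogates (the radial plateau `radialCutoffC r` is `≡ 1`
on the Fermi region and makes the angular factor smooth through `k⃗ = 0`). [cite: BenfattoGiulianiMastropietro2006, §2.5 (2.49) p0010:L72] -/
def bgmSurrogateIntegrand (μ e₀ r : ℝ) (E : ℤ → ℝ × (Fin 2 → ℝ) → ℂ) (h : ℤ) (m : ℕ) (ω : ℤ)
    (p : ℝ × (Fin 2 → ℝ)) : ℂ :=
  ((bgmShellSurrogate e₀ ((((4 : ℝ) ^ (-h) : ℝ) : ℂ) * bgmDenom μ E h p)
        ((((4 : ℝ) ^ (-h) : ℝ) : ℂ) * bgmDenom μ E (h - 1) p) *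
      (radialCutoffC r (momToComplex p.2) * sectorWeightCirc m ω (polarAngle p.2)) : ℝ) : ℂ) *
    bgmInvSurrogate e₀ ((((4 : ℝ) ^ (-h) : ℝ) : ℂ) * bgmDenom μ E (h - 1) p)

/-- **`F_{h,ω}/D_{h-1} = γ^{-h} Φ̃`** wherever the radial plateau is `1` on the support (pointwise; both
sides vanish off the support of `f_h`). [cite: BenfattoGiulianiMastropietro2006, §2.5 (2.49) p0010:L72] -/
theorem sectorIntegrand_eq_bgmSurrogateIntegrand {r : ℝ} (hr : 0 < r) (he : 0 < e₀) {p : ℝ × (Fin 2 → ℝ)}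
    (hη : ‖E h p - E (h - 1) p‖ ≤ 3 / 16 * e₀ * (4 : ℝ) ^ h) (m : ℕ) (ω : ℤ)
    (hplat : bgmShell e₀ μ E h p ≠ 0 → r ≤ ‖momToComplex p.2‖) :
    ((bgmSectorFn e₀ μ E h m ω p : ℝ) : ℂ) / bgmDenom μ E (h - 1) p =
      (((4 : ℝ) ^ (-h) : ℝ) : ℂ) * bgmSurrogateIntegrand μ e₀ r E h m ω p := by
  by_cases hf : bgmShell e₀ μ E h p = 0
  · have h0 : bgmShellSurrogate e₀ ((((4 : ℝ) ^ (-h) : ℝ) : ℂ) * bgmDenom μ E h p)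
        ((((4 : ℝ) ^ (-h) : ℝ) : ℂ) * bgmDenom μ E (h - 1) p) = 0 := by
      rw [bgmShellSurrogate_eq_bgmShell, hf]
    rw [bgmSurrogateIntegrand, h0]
    simp [bgmSectorFn, hf]
  · rw [sectorIntegrand_eq_surrogate he hη m ω, bgmSurrogateIntegrand, radialCutoffC_eq_one hr (hplat hf), one_mul]
    ring

/-- The surrogate integrand of (2.49) is smooth in `k⃗` on all of `ℝ²` (`r > 0`). [cite: BenfattoGiulianiMastropietro2006, §2.5 (2.49) p0010:L72] -/
theorem contDiff_bgmSurrogateIntegrand_slice (hS : BGMSmoothness β U C hβ E) (he : 0 < e₀) {r : ℝ} (hr : 0 < r)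
    (μ k₀ : ℝ) (h : ℤ) (m : ℕ) (ω : ℤ) {n : ℕ} :
    ContDiff ℝ n fun q : Fin 2 → ℝ => bgmSurrogateIntegrand μ e₀ r E h m ω (k₀, q) := by
  have hD : ∀ h' : ℤ, ContDiff ℝ n fun q : Fin 2 → ℝ => (((4 : ℝ) ^ (-h) : ℝ) : ℂ) * bgmDenom μ E h' (k₀, q) :=
    fun h' => by
      simp only [bgmDenom]
      exact contDiff_const.mul (contDiff_const.add ((hS.1 h' k₀ n).sub contDiff_const))
  have hS' : ContDiff ℝ n fun q : Fin 2 → ℝ => bgmShellSurrogate e₀ ((((4 : ℝ) ^ (-h) : ℝ) : ℂ) * bgmDenom μ E h (k₀, q))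
      ((((4 : ℝ) ^ (-h) : ℝ) : ℂ) * bgmDenom μ E (h - 1) (k₀, q)) := by
    unfold bgmShellSurrogate
    exact ((contDiff_bgmCutoffSq he).comp ((hD h).norm_sq ℝ)).sub
      ((contDiff_bgmCutoffSq he).comp (contDiff_const.mul ((hD (h - 1)).norm_sq ℝ)))
  have hZ := contDiff_radial_mul_sectorWeightCirc_polarAngle hr m ω (m := n)
  have hI' : ContDiff ℝ n fun q : Fin 2 → ℝ => bgmInvSurrogate e₀ ((((4 : ℝ) ^ (-h) : ℝ) : ℂ) * bgmDenom μ E (h - 1) (k₀, q)) := by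
    unfold bgmInvSurrogate
    have hq₀ : 0 < e₀ ^ 2 / 128 := by positivity
    exact (Complex.conjCLE.contDiff.comp (hD (h - 1))).mul
      (Complex.ofRealCLM.contDiff.comp ((contDiff_sectorInvCutoff hq₀).comp ((hD (h - 1)).norm_sq ℝ)))
  unfold bgmSurrogateIntegrand
  exact (Complex.ofRealCLM.contDiff.comp (hS'.mul hZ)).mul hI'

/-- **The rescaled denominators along a rescaled spatial line, all orders `≤ N` at the base point**:
if `|D_{h'}(k₀, q⃗)| ≤ 2e₀γ^h` (closure of the support) then every derivative of order `l ≤ N` of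
`σ ↦ γ^{-h}D_{h'}(k₀, q⃗ + σγ^h v)` at `σ = 0` is bounded by `2e₀ + 4 + 2^{N+2}4^N Σ_{i≤N}|C_i|` (`c₀ ≤ 1`).
[cite: BenfattoGiulianiMastropietro2006, §2.5 proof of Lemma 2.2 (2.53)–(2.55) p0011:L7–L20] -/
theorem norm_iteratedDeriv_rescaledDenom_line_le (hI : BGMInitial E) (hS : BGMSmoothness β U C hβ E) (he : 0 < e₀)
    (hh₁ : hβ ≤ h) (hh₀ : h ≤ 0) {h' : ℤ} (hh'₁ : h - 1 ≤ h') (hh'₀ : h' ≤ h) (hU : |U| ≤ c₀)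
    (hUh : |U| * |(hβ : ℝ)| ≤ c₀) (hc₁ : c₀ ≤ 1) {k₀ : ℝ} (hk₀ : k₀ ∈ matsubaraSet β) (q v : Fin 2 → ℝ)
    (hv : ‖v‖ ≤ 1) (hD0 : ‖bgmDenom μ E h' (k₀, q)‖ ≤ 2 * e₀ * (4 : ℝ) ^ h) (N : ℕ) {l : ℕ} (hl : l ≤ N) :
    ‖iteratedDeriv l (fun σ : ℝ => (((4 : ℝ) ^ (-h) : ℝ) : ℂ) * bgmDenom μ E h' (k₀, q + σ • ((4 : ℝ) ^ h • v))) 0‖ ≤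
      2 * e₀ + (4 + 2 ^ (N + 2) * 4 ^ N * ∑ i ∈ Finset.range (N + 1), |C i|) := by
  have hc₀ : 0 ≤ c₀ := (abs_nonneg U).trans hU
  have h4n : (0 : ℝ) < (4 : ℝ) ^ (-h) := zpow_pos (by norm_num) _
  have hCs0 : 0 ≤ ∑ i ∈ Finset.range (N + 1), |C i| := Finset.sum_nonneg fun i _ => abs_nonneg _
  have hP : 0 ≤ 2 ^ (N + 2) * 4 ^ N * ∑ i ∈ Finset.range (N + 1), |C i| := by positivity
  rcases Nat.eq_zero_or_pos l with rfl | hl1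
  · rw [iteratedDeriv_zero]
    simp only [zero_smul, add_zero, norm_mul, Complex.norm_real, Real.norm_of_nonneg h4n.le]
    calc (4 : ℝ) ^ (-h) * ‖bgmDenom μ E h' (k₀, q)‖ ≤ (4 : ℝ) ^ (-h) * (2 * e₀ * (4 : ℝ) ^ h) :=
          mul_le_mul_of_nonneg_left hD0 h4n.le
      _ = 2 * e₀ := by rw [zpow_neg]; field_simp
      _ ≤ _ := by linarith
  · rw [iteratedDeriv_rescaledDenom_line hS μ _ h h' q v hl1, norm_mul, Complex.norm_real,
      Real.norm_of_nonneg h4n.le]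
    have h1 := norm_iteratedDeriv_rescaled_dispersion_line_le hI hS hh₁ hh₀ hh'₁ hh'₀ hU hUh hk₀ q v hv 0 hl1 hl
    have hCle : |C l| ≤ ∑ i ∈ Finset.range (N + 1), |C i| :=
      Finset.single_le_sum (f := fun i => |C i|) (fun i _ => abs_nonneg _) (Finset.mem_range.2 (Nat.lt_succ_of_le hl))
    have hc2 : c₀ ^ 2 ≤ 1 := by nlinarith
    calc _ ≤ 4 + 2 ^ (N + 2) * 4 ^ N * |C l| * c₀ ^ 2 := h1
      _ ≤ 4 + 2 ^ (N + 2) * 4 ^ N * (∑ i ∈ Finset.range (N + 1), |C i|) * 1 := by gcongr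
      _ ≤ _ := by linarith

/-- The angular cost of a rescaled unit step: `(1 + N!/w_m)‖γ^h v‖/c ≤ 2(1+N!)/c` when `γ^h ≤ w_m`,
`‖v‖ ≤ 1`. [folklore] -/
private theorem angular_cost_le {m : ℕ} (hh₀ : h ≤ 0) (hwm : (4 : ℝ) ^ h ≤ sectorWidth m) (N : ℕ) {c : ℝ} (hc : 0 < c)
    {v : Fin 2 → ℝ} (hv : ‖v‖ ≤ 1) :
    (1 + (sectorWidth m)⁻¹ * N !) * ‖momToComplex ((4 : ℝ) ^ h • v)‖ / c ≤ 2 * (1 + N !) / c := by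
  have h4h : (0 : ℝ) < (4 : ℝ) ^ h := zpow_pos (by norm_num) _
  have h4h1 : (4 : ℝ) ^ h ≤ 1 := zpow_le_one_of_nonpos₀ (by norm_num) hh₀
  have hwpos := sectorWidth_pos m
  have hv0 : |v 0| ≤ 1 := by
    have := norm_le_pi_norm v 0; rw [Real.norm_eq_abs] at this; exact this.trans hv
  have hv1 : |v 1| ≤ 1 := by
    have := norm_le_pi_norm v 1; rw [Real.norm_eq_abs] at this; exact this.trans hv
  have hwm' : ‖momToComplex ((4 : ℝ) ^ h • v)‖ ≤ 2 * (4 : ℝ) ^ h := by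
    calc ‖momToComplex ((4 : ℝ) ^ h • v)‖ ≤ |((4 : ℝ) ^ h • v) 0| + |((4 : ℝ) ^ h • v) 1| := norm_momToComplex_le _
      _ = (4 : ℝ) ^ h * |v 0| + (4 : ℝ) ^ h * |v 1| := by
          simp only [Pi.smul_apply, smul_eq_mul, abs_mul, abs_of_pos h4h]
      _ ≤ (4 : ℝ) ^ h * 1 + (4 : ℝ) ^ h * 1 := by gcongr
      _ = 2 * (4 : ℝ) ^ h := by ring
  have h3 : (sectorWidth m)⁻¹ * (4 : ℝ) ^ h ≤ 1 := by rw [inv_mul_le_iff₀ hwpos]; linarith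
  have hN0 : (0 : ℝ) ≤ N ! := by positivity
  refine div_le_div_of_nonneg_right ?_ hc.le
  calc (1 + (sectorWidth m)⁻¹ * N !) * ‖momToComplex ((4 : ℝ) ^ h • v)‖
      ≤ (1 + (sectorWidth m)⁻¹ * N !) * (2 * (4 : ℝ) ^ h) := mul_le_mul_of_nonneg_left hwm' (by positivity)
    _ = 2 * ((4 : ℝ) ^ h + ((sectorWidth m)⁻¹ * (4 : ℝ) ^ h) * N !) := by ring
    _ ≤ 2 * (1 + 1 * N !) := by gcongr
    _ = 2 * (1 + N !) := by ring

/-- **The (plateaued) angular factor along a rescaled spatial line, all orders `≤ N` at the base point**: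
for `‖q⃗‖ ≥ c`, `γ^h ≤ w_m`, `‖v‖ ≤ 1`, with `B` the constant of
`exists_norm_iteratedDeriv_sectorWeightCirc_polarAngle_line_le N`:
`‖∂_σˡ [χ_{c/2}(q⃗ + σγ^h v) ζ_{m,ω}(θ(q⃗ + σγ^h v))]|_{σ=0}‖ ≤ N! B max(1, 2(1+N!)/c)^N`.
[cite: BenfattoGiulianiMastropietro2006, §2.5 Lemma 2.2 (2.45)–(2.46) p0010:L33] -/
theorem norm_iteratedDeriv_angular_line_le {m : ℕ} (hh₀ : h ≤ 0) (hwm : (4 : ℝ) ^ h ≤ sectorWidth m) (ω : ℤ)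
    (N : ℕ) {c : ℝ} (hc : 0 < c) {B : ℝ} (hB0 : 0 ≤ B)
    (hB : ∀ (i : ℕ), i ≤ N → ∀ (n : ℕ) (ω : ℤ) (θ₀ : ℝ) (q w : Fin 2 → ℝ) (t : ℝ) {r₀ : ℝ}, 0 < r₀ →
      r₀ ≤ ‖momToComplex (q + t • w)‖ → |sectorRelAngle θ₀ (q + t • w)| < π →
      ‖iteratedDeriv i (fun t : ℝ => sectorWeightCirc n ω (polarAngle (q + t • w))) t‖ ≤
        N ! * B * ((1 + (sectorWidth n)⁻¹ * N !) * ‖momToComplex w‖ / r₀) ^ i)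
    {q v : Fin 2 → ℝ} (hq : c ≤ ‖momToComplex q‖) (hv : ‖v‖ ≤ 1) {l : ℕ} (hl : l ≤ N) :
    ‖iteratedDeriv l (fun σ : ℝ => radialCutoffC (c / 2) (momToComplex (q + σ • ((4 : ℝ) ^ h • v))) *
        sectorWeightCirc m ω (polarAngle (q + σ • ((4 : ℝ) ^ h • v)))) 0‖ ≤
      N ! * B * (max 1 (2 * (1 + N !) / c)) ^ N := by
  have hopen : IsOpen {s : ℝ | c / 2 < ‖momToComplex (q + s • ((4 : ℝ) ^ h • v))‖} :=
    isOpen_lt continuous_const (continuous_norm.comp ((contDiff_momToComplex (m := 0)).continuous.comp (by fun_prop)))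
  have hmem : (0 : ℝ) ∈ {s : ℝ | c / 2 < ‖momToComplex (q + s • ((4 : ℝ) ^ h • v))‖} := by
    show c / 2 < ‖momToComplex (q + (0 : ℝ) • ((4 : ℝ) ^ h • v))‖
    rw [zero_smul, add_zero]; linarith
  have hev : (fun σ : ℝ => radialCutoffC (c / 2) (momToComplex (q + σ • ((4 : ℝ) ^ h • v))) *
        sectorWeightCirc m ω (polarAngle (q + σ • ((4 : ℝ) ^ h • v)))) =ᶠ[𝓝 0]
      fun s : ℝ => sectorWeightCirc m ω (polarAngle (q + s • ((4 : ℝ) ^ h • v))) := by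
    filter_upwards [hopen.mem_nhds hmem] with s hs
    rw [radialCutoffC_eq_one (by positivity) (le_of_lt hs), one_mul]
  rw [hev.iteratedDeriv_eq]
  have hΘ : |sectorRelAngle (polarAngle q) (q + (0 : ℝ) • ((4 : ℝ) ^ h • v))| < π := by
    rw [zero_smul, add_zero, sectorRelAngle_polarAngle_self q, abs_zero]; exact Real.pi_pos
  have hr : c ≤ ‖momToComplex (q + (0 : ℝ) • ((4 : ℝ) ^ h • v))‖ := by rw [zero_smul, add_zero]; exact hq
  have h1 := hB l hl m ω (polarAngle q) q ((4 : ℝ) ^ h • v) 0 hc hr hΘ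
  refine h1.trans ?_
  have hcost := angular_cost_le hh₀ hwm N hc hv
  have hcost0 : 0 ≤ (1 + (sectorWidth m)⁻¹ * N !) * ‖momToComplex ((4 : ℝ) ^ h • v)‖ / c := by
    have := sectorWidth_pos m; positivity
  have hm1 : (1 : ℝ) ≤ max 1 (2 * (1 + N !) / c) := le_max_left _ _
  have hpow1 : ((1 + (sectorWidth m)⁻¹ * N !) * ‖momToComplex ((4 : ℝ) ^ h • v)‖ / c) ^ l ≤
      (max 1 (2 * (1 + N !) / c)) ^ l := pow_le_pow_left₀ hcost0 (hcost.trans (le_max_right _ _)) l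
  have hpow2 : (max 1 (2 * (1 + N !) / c)) ^ l ≤ (max 1 (2 * (1 + N !) / c)) ^ N := pow_le_pow_right₀ hm1 hl
  exact mul_le_mul_of_nonneg_left (hpow1.trans hpow2) (by positivity)

/-- **Lemma 2.2/2.3, the momentum directions — all-order bounds along rescaled spatial lines.** For
`-4 < μ`, admissible `e₀`, the constants `C` of (2.36), every `N` and every `0 ≤ c₀ ≤ 1` there is
`K ≥ 0` such that: under `E_0 = ε₀`, (2.36) for `h_β ≤ h ≤ 0` with `|U| ≤ c₀`, `|U||h_β| ≤ c₀` and the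
two smallness constraints of the support lemmas, for every scale `h_β ≤ h ≤ 0`, every angular index with
`γ^h ≤ w_m` (both the anisotropic `m = n` and the isotropic `m = 2n` qualify), every Matsubara
frequency, every point `q⃗` of the CLOSURE of the support of `f_h(k₀, ·)` and every direction `‖v‖ ≤ 1`:
`‖∂_σⁱ Φ̃(k₀, q⃗ + σγ^h v)|_{σ=0}‖ ≤ K` for all `i ≤ N` — every derivative of `F_{h,ω}/D_{h-1}` along
`q⃗ + s v` costs a factor `γ^{-h}` (BGM: the `γ^h|x'₁|`, `γ^h|x⃗|` of (2.52)/(2.60) "integrating by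
parts" against "the dimensional bound"). [cite: BenfattoGiulianiMastropietro2006, §2.5 proof of Lemma 2.2 (2.51)–(2.56) p0011:L7–L33, Lemma 2.3 (2.60) p0011:L154] -/
theorem exists_norm_iteratedDeriv_bgmSurrogateIntegrand_line_le {μ e₀ : ℝ} (he : 0 < e₀) (he4 : e₀ < μ + 4)
    (C : ℕ → ℝ) (N : ℕ) {c₀ : ℝ} (hc₁ : c₀ ≤ 1) :
    ∃ K : ℝ, 0 ≤ K ∧ ∀ (β U : ℝ) (hβ : ℤ) (E : ℤ → ℝ × (Fin 2 → ℝ) → ℂ),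
      BGMInitial E → BGMSmoothness β U C hβ E → |U| ≤ c₀ → |U| * |(hβ : ℝ)| ≤ c₀ →
      |C 0| * c₀ ≤ 3 / 16 * e₀ → 2 * |C 0| * c₀ ≤ (μ + 4 - e₀) / 2 →
      ∀ h : ℤ, hβ ≤ h → h ≤ 0 → ∀ (m : ℕ) (ω : ℤ), (4 : ℝ) ^ h ≤ sectorWidth m →
      ∀ (j : ℤ) (q v : Fin 2 → ℝ), ‖v‖ ≤ 1 →
      q ∈ closure {q | bgmShell e₀ μ E h (fermiMatsubara β j, q) ≠ 0} →
      ∀ i ≤ N, ‖iteratedDeriv i (fun σ : ℝ =>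
        bgmSurrogateIntegrand μ e₀ (Real.sqrt ((μ + 4 - e₀) / 2) / 2) E h m ω
          (fermiMatsubara β j, q + σ • ((4 : ℝ) ^ h • v))) 0‖ ≤ K := by
  -- constants
  obtain ⟨c, hc⟩ : ∃ c : ℝ, c = Real.sqrt ((μ + 4 - e₀) / 2) := ⟨_, rfl⟩
  have hcpos : 0 < c := by rw [hc]; exact Real.sqrt_pos.2 (by linarith)
  have hcsq : c ^ 2 = (μ + 4 - e₀) / 2 := by rw [hc]; exact Real.sq_sqrt (by linarith)
  obtain ⟨M, hM⟩ : ∃ M : ℝ, M = 2 * e₀ + (4 + 2 ^ (N + 2) * 4 ^ N * ∑ i ∈ Finset.range (N + 1), |C i|) := ⟨_, rfl⟩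
  obtain ⟨Ba, hBa0, hBa⟩ := exists_norm_iteratedDeriv_sectorWeightCirc_polarAngle_line_le N
  obtain ⟨Z, hZ⟩ : ∃ Z : ℝ, Z = N ! * Ba * (max 1 (2 * (1 + N !) / c)) ^ N := ⟨_, rfl⟩
  obtain ⟨K, hK0, hK⟩ := exists_norm_iteratedDeriv_surrogateProduct_le he N M Z
  refine ⟨K, hK0, ?_⟩
  intro β U hβ E hI hS hU hUh hK₀ hgap' h hh₁ hh₀ m ω hwm j q v hv hq i hi
  rw [← hc]
  have hk₀ : fermiMatsubara β j ∈ matsubaraSet β := ⟨j, rfl⟩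
  have h4h : (0 : ℝ) < (4 : ℝ) ^ h := zpow_pos (by norm_num) _
  -- the three curves
  obtain ⟨a, ha⟩ : ∃ a : ℝ → ℂ, a = fun σ => (((4 : ℝ) ^ (-h) : ℝ) : ℂ) *
    bgmDenom μ E h (fermiMatsubara β j, q + σ • ((4 : ℝ) ^ h • v)) := ⟨_, rfl⟩
  obtain ⟨b, hb⟩ : ∃ b : ℝ → ℂ, b = fun σ => (((4 : ℝ) ^ (-h) : ℝ) : ℂ) *
    bgmDenom μ E (h - 1) (fermiMatsubara β j, q + σ • ((4 : ℝ) ^ h • v)) := ⟨_, rfl⟩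
  obtain ⟨z, hz⟩ : ∃ z : ℝ → ℝ, z = fun σ => radialCutoffC (c / 2) (momToComplex (q + σ • ((4 : ℝ) ^ h • v))) *
    sectorWeightCirc m ω (polarAngle (q + σ • ((4 : ℝ) ^ h • v))) := ⟨_, rfl⟩
  have hfun : (fun σ : ℝ => bgmSurrogateIntegrand μ e₀ (c / 2) E h m ω (fermiMatsubara β j, q + σ • ((4 : ℝ) ^ h • v))) =
      fun σ => ((bgmShellSurrogate e₀ (a σ) (b σ) * z σ : ℝ) : ℂ) * bgmInvSurrogate e₀ (b σ) := by
    funext σ; rw [ha, hb, hz]; rfl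
  rw [hfun]
  have hac : ContDiff ℝ N a := by rw [ha]; exact contDiff_rescaledDenom_line hS μ _ h h q v
  have hbc : ContDiff ℝ N b := by rw [hb]; exact contDiff_rescaledDenom_line hS μ _ h (h - 1) q v
  have hzc : ContDiff ℝ N z := by
    have hl : ContDiff ℝ N fun σ : ℝ => q + σ • ((4 : ℝ) ^ h • v) := by fun_prop
    have h1 := (contDiff_radial_mul_sectorWeightCirc_polarAngle (by positivity : 0 < c / 2) m ω (m := N)).comp hl
    rw [hz]
    exact h1
  -- the closure bounds at `σ = 0`
  obtain ⟨hDh, hDh1, hqq⟩ := closure_support_bounds hI hS he hh₁ hh₀ hU hUh hK₀ hgap' hq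
  have hDh' : ‖bgmDenom μ E h (fermiMatsubara β j, q)‖ ≤ 2 * e₀ * (4 : ℝ) ^ h := by
    refine hDh.trans ?_; nlinarith [he, h4h]
  have hMa : ∀ l ≤ N, ‖iteratedDeriv l a 0‖ ≤ M := fun l hl => by
    rw [ha, hM]
    exact norm_iteratedDeriv_rescaledDenom_line_le hI hS he hh₁ hh₀ (h' := h) (by omega) le_rfl hU hUh hc₁ hk₀
      q v hv hDh' N hl
  have hMb : ∀ l ≤ N, ‖iteratedDeriv l b 0‖ ≤ M := fun l hl => by
    rw [hb, hM]
    exact norm_iteratedDeriv_rescaledDenom_line_le hI hS he hh₁ hh₀ (h' := h - 1) le_rfl (by omega) hU hUh hc₁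
      hk₀ q v hv hDh1 N hl
  -- the angular factor
  have hnq : c ≤ ‖momToComplex q‖ := by
    have h1 : c ^ 2 ≤ ‖momToComplex q‖ ^ 2 := by rw [norm_momToComplex_sq, hcsq]; exact hqq
    exact (pow_le_pow_iff_left₀ hcpos.le (norm_nonneg _) two_ne_zero).1 h1
  have hZb : ∀ l ≤ N, ‖iteratedDeriv l z 0‖ ≤ Z := fun l hl => by
    rw [hz, hZ]
    exact norm_iteratedDeriv_angular_line_le hh₀ hwm ω N hcpos hBa0 hBa hnq hv hl
  exact hK a b z 0 hac hbc hzc hMa hMb hZb i hi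


/-! ### §5 The Matsubara direction: discrete `k₀`-differences through Newton interpolation -/

/-- Consecutive fermionic Matsubara frequencies: `k₀(j₀ + k) = k₀(j₀) + (2π/β)k`. [cite: BenfattoGiulianiMastropietro2006, §1 (1.4)(b) p0002:L84] -/
theorem fermiMatsubara_add_nat (β : ℝ) (j₀ : ℤ) (k : ℕ) :
    fermiMatsubara β (j₀ + k) = fermiMatsubara β j₀ + 2 * π / β * k := by
  simp only [fermiMatsubara]; push_cast; ring

/-- **(2.36aa) ↔ Mathlib's forward differences**: `∂_{k₀}^a f(k₀, q⃗) = (2π/β)^{-a} (Δ_{2π/β}^a f(·, q⃗))(k₀)`.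
[cite: BenfattoGiulianiMastropietro2006, §2.3 (2.36aa) p0008:L55] -/
theorem bgmTimeDiffIter_eq_fwdDiff (β : ℝ) (a : ℕ) (f : ℝ × (Fin 2 → ℝ) → ℂ) (k₀ : ℝ) (q : Fin 2 → ℝ) :
    bgmTimeDiffIter β a f (k₀, q) =
      (((2 * π / β)⁻¹) ^ a : ℝ) • ((fwdDiff (2 * π / β))^[a] (fun t : ℝ => f (t, q))) k₀ := by
  induction a generalizing k₀ with
  | zero => simp [bgmTimeDiffIter_zero']
  | succ a ih =>
    have hrec : bgmTimeDiffIter β (a + 1) f (k₀, q) = bgmDiff β 1 0 (bgmTimeDiffIter β a f) (k₀, q) := rfl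
    rw [hrec, bgmDiff]
    simp only [bgmStep, bgmShift, if_true, Prod.mk_add_mk, add_zero]
    rw [ih (k₀ + 2 * π / β), ih k₀, ← smul_sub, smul_smul, Function.iterate_succ_apply', inv_div, pow_succ']
    rfl

/-- `(Δ_h)ᵃ (F - G) = (Δ_h)ᵃ F - (Δ_h)ᵃ G`. [folklore] -/
private theorem fwdDiff_iter_sub' (δ : ℝ) (F G : ℝ → ℂ) (a : ℕ) :
    (fwdDiff δ)^[a] (F - G) = (fwdDiff δ)^[a] F - (fwdDiff δ)^[a] G := by
  simpa only [fwdDiff_aux.coe_fwdDiffₗ_pow] using map_sub (fwdDiff_aux.fwdDiffₗ ℝ ℂ δ ^ a) F G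

/-- `(Δ_h)ᵃ c = 0` for `a ≥ 1`. [folklore] -/
private theorem fwdDiff_iter_const_eq_zero (δ : ℝ) (c : ℂ) {a : ℕ} (ha : 1 ≤ a) :
    (fwdDiff δ)^[a] (fun _ : ℝ => c) = 0 := by
  obtain ⟨a', rfl⟩ : ∃ a', a = a' + 1 := ⟨a - 1, by omega⟩
  rw [Function.iterate_succ_apply, fwdDiff_const]
  change (fwdDiff δ)^[a'] (0 : ℝ → ℂ) = 0
  simpa only [fwdDiff_aux.coe_fwdDiffₗ_pow] using map_zero (fwdDiff_aux.fwdDiffₗ ℝ ℂ δ ^ a')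

/-- **One increment of (2.36) in the time direction**: for `h_β ≤ -m`, `k₀ ∈ D_β`, `a ≥ 1`,
`‖Δ_{2π/β}^a (E_{-m} - E_{-m-1})(·, q⃗)(k₀)‖ ≤ (2π/β)^a |C_a| U² m γ^{(a-2)m}`. [cite: BenfattoGiulianiMastropietro2006, §2.3 (2.36) p0008:L46] -/
theorem norm_fwdDiff_increment_le (hS : BGMSmoothness β U C hβ E) (hβpos : 0 < β) {m : ℕ} (hm : hβ ≤ -(m : ℤ))
    {k₀ : ℝ} (hk₀ : k₀ ∈ matsubaraSet β) {a : ℕ} (ha : 1 ≤ a) (q : Fin 2 → ℝ) :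
    ‖((fwdDiff (2 * π / β))^[a] (fun t : ℝ => E (-(m : ℤ)) (t, q) - E (-(m : ℤ) - 1) (t, q))) k₀‖ ≤
      (2 * π / β) ^ a * (|C a| * U ^ 2 * ((m : ℝ) * (4 : ℝ) ^ (((a : ℤ) - 2) * (m : ℤ)))) := by
  have hδ : 0 < 2 * π / β := by positivity
  have hbd := (hS.2.2 (-(m : ℤ)) hm (by omega)).2 a 0 (by omega) Fin.elim0 k₀ hk₀ q
  have hcast : |(((-(m : ℤ)) : ℤ) : ℝ)| = m := by push_cast; rw [abs_neg, Nat.abs_cast]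
  have hexp : ((2 : ℤ) - (a : ℤ)) * (-(m : ℤ)) = ((a : ℤ) - 2) * (m : ℤ) := by ring
  simp only [mixedPartial, iteratedFDeriv_zero_apply, add_zero, hcast] at hbd
  rw [hexp, bgmTimeDiffIter_eq_fwdDiff, norm_smul, norm_pow, norm_inv, Real.norm_of_nonneg hδ.le] at hbd
  have hpow : (0 : ℝ) < (2 * π / β) ^ a := pow_pos hδ a
  have hkey : ‖((fwdDiff (2 * π / β))^[a] (fun t : ℝ => E (-(m : ℤ)) (t, q) - E (-(m : ℤ) - 1) (t, q))) k₀‖ =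
      (2 * π / β) ^ a * (((2 * π / β)⁻¹) ^ a *
        ‖((fwdDiff (2 * π / β))^[a] (fun t : ℝ => E (-(m : ℤ)) (t, q) - E (-(m : ℤ) - 1) (t, q))) k₀‖) := by
    rw [← mul_assoc, ← mul_pow, mul_inv_cancel₀ hδ.ne', one_pow, one_mul]
  rw [hkey]
  refine mul_le_mul_of_nonneg_left (hbd.trans ?_) hpow.le
  rw [sq_abs]
  calc C a * U ^ 2 * (m : ℝ) * (4 : ℝ) ^ (((a : ℤ) - 2) * (m : ℤ))
      = C a * (U ^ 2 * ((m : ℝ) * (4 : ℝ) ^ (((a : ℤ) - 2) * (m : ℤ)))) := by ring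
    _ ≤ |C a| * (U ^ 2 * ((m : ℝ) * (4 : ℝ) ^ (((a : ℤ) - 2) * (m : ℤ)))) :=
        mul_le_mul_of_nonneg_right (le_abs_self _) (by positivity)
    _ = _ := by ring


/-- **All discrete time differences of the moving dispersion** ((2.36) telescoped from the
`k₀`-INDEPENDENT `E_0 = ε₀`): for `h_β - 1 ≤ h' ≤ 0`, a Matsubara `k₀` and `a ≥ 1`,
`‖Δ_{2π/β}^a E_{h'}(·, q⃗)(k₀)‖ ≤ (2π/β)^a |C_a| U² T_a`, `T_1 = 2`, `T_a = h'² γ^{-(a-2)h'}` (`a ≥ 2`).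
[cite: BenfattoGiulianiMastropietro2006, §2.4 (2.42) p0009:L95–L101] -/
theorem norm_fwdDiff_dispersion_le (hI : BGMInitial E) (hS : BGMSmoothness β U C hβ E) (hβpos : 0 < β) {h' : ℤ}
    (hh₁ : hβ - 1 ≤ h') (hh₀ : h' ≤ 0) {k₀ : ℝ} (hk₀ : k₀ ∈ matsubaraSet β) {a : ℕ} (ha : 1 ≤ a) (q : Fin 2 → ℝ) :
    ‖((fwdDiff (2 * π / β))^[a] (fun t : ℝ => E h' (t, q))) k₀‖ ≤
      (2 * π / β) ^ a * (|C a| * U ^ 2 *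
        (if a = 1 then 2 else ((-h' : ℤ) : ℝ) ^ 2 * (4 : ℝ) ^ (((a : ℤ) - 2) * (-h')))) := by
  set n := (-h').toNat with hn
  have hnz : ((n : ℕ) : ℤ) = -h' := Int.toNat_of_nonneg (by omega)
  have hmem : ∀ m ∈ Finset.range n, hβ ≤ -(m : ℤ) := fun m hm => by
    have := Finset.mem_range.1 hm; omega
  set g : ℕ → ℝ → ℂ := fun m t => E (-(m : ℤ)) (t, q) - E (-(m : ℤ) - 1) (t, q) with hg
  have hE : (fun t : ℝ => E h' (t, q)) = (fun _ : ℝ => ((sqDispersion q : ℝ) : ℂ)) - ∑ m ∈ Finset.range n, g m := by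
    funext t
    rw [bgm_telescope E hh₀ (t, q), hI]
    simp only [Pi.sub_apply, Finset.sum_apply, hg]
    rfl
  rw [hE, fwdDiff_iter_sub', fwdDiff_iter_const_eq_zero _ _ ha, zero_sub, Pi.neg_apply, norm_neg,
    fwdDiff_iter_finsetSum, Finset.sum_apply]
  have hterm : ∀ m ∈ Finset.range n, ‖((fwdDiff (2 * π / β))^[a] (g m)) k₀‖ ≤
      (2 * π / β) ^ a * (|C a| * U ^ 2 * ((m : ℝ) * (4 : ℝ) ^ (((a : ℤ) - 2) * (m : ℤ)))) :=
    fun m hm => norm_fwdDiff_increment_le hS hβpos (hmem m hm) hk₀ ha q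
  have hT : ∑ m ∈ Finset.range n, (m : ℝ) * (4 : ℝ) ^ (((a : ℤ) - 2) * (m : ℤ)) ≤
      (if a = 1 then 2 else ((-h' : ℤ) : ℝ) ^ 2 * (4 : ℝ) ^ (((a : ℤ) - 2) * (-h'))) := by
    split_ifs with h1
    · subst h1
      simpa using sum_mul_four_zpow_neg_le n
    · have h2 : 2 ≤ a := by omega
      have hnr : (n : ℝ) = ((-h' : ℤ) : ℝ) := by exact_mod_cast hnz
      have := sum_mul_zpow_le_sq_mul n h2
      rwa [hnz, hnr] at this
  calc _ ≤ ∑ m ∈ Finset.range n, ‖((fwdDiff (2 * π / β))^[a] (g m)) k₀‖ := norm_sum_le _ _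
    _ ≤ ∑ m ∈ Finset.range n, (2 * π / β) ^ a * (|C a| * U ^ 2 * ((m : ℝ) * (4 : ℝ) ^ (((a : ℤ) - 2) * (m : ℤ)))) :=
        Finset.sum_le_sum hterm
    _ = (2 * π / β) ^ a * (|C a| * U ^ 2 * ∑ m ∈ Finset.range n, (m : ℝ) * (4 : ℝ) ^ (((a : ℤ) - 2) * (m : ℤ))) := by
        rw [Finset.mul_sum, Finset.mul_sum]
    _ ≤ _ := by gcongr

/-- The `ℕ`-indexed differences of grid samples are the real forward differences:
`(Δ₁ᵏ (l ↦ g(t₀ + δl)))(0) = (Δ_δ^k g)(t₀)`. [folklore] -/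
private theorem fwdDiff_iter_nat_grid (g : ℝ → ℂ) (t₀ δ : ℝ) (k : ℕ) :
    ((fwdDiff (1 : ℕ))^[k] (fun l : ℕ => g (t₀ + δ * l))) 0 = ((fwdDiff δ)^[k] g) t₀ := by
  rw [fwdDiff_iter_eq_sum_shift, fwdDiff_iter_eq_sum_shift]
  refine Finset.sum_congr rfl fun l _ => ?_
  simp only [zero_add, smul_eq_mul, mul_one, nsmul_eq_mul]
  ring_nf

/-- The scale arithmetic of the telescoped bounds after rescaling by `γ^h`: for `h_β ≤ h ≤ 0`,
`h' ∈ {h-1, h}`, `1 ≤ k ≤ N`: `γ^{(k-1)h} |C_k| U² T_k(h') ≤ 2^{N+2} 4^N |C_k| c₀²`. [folklore] -/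
private theorem scale_arith (hh₁ : hβ ≤ h) (hh₀ : h ≤ 0) {h' : ℤ} (hh'₁ : h - 1 ≤ h') (hh'₀ : h' ≤ h) (hU : |U| ≤ c₀)
    (hUh : |U| * |(hβ : ℝ)| ≤ c₀) {k N : ℕ} (hk : 1 ≤ k) (hkN : k ≤ N) :
    (4 : ℝ) ^ (h * ((k : ℤ) - 1)) * (|C k| * U ^ 2 *
        (if k = 1 then 2 else ((-h' : ℤ) : ℝ) ^ 2 * (4 : ℝ) ^ (((k : ℤ) - 2) * (-h')))) ≤
      2 ^ (N + 2) * 4 ^ N * |C k| * c₀ ^ 2 := by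
  have hc₀ : 0 ≤ c₀ := (abs_nonneg U).trans hU
  have hle1 : (4 : ℝ) ^ (h * ((k : ℤ) - 1)) ≤ 1 :=
    zpow_le_one_of_nonpos₀ (by norm_num) (mul_nonpos_of_nonpos_of_nonneg hh₀ (by omega))
  have hUc : U ^ 2 ≤ c₀ ^ 2 := by rw [← sq_abs]; exact pow_le_pow_left₀ (abs_nonneg U) hU 2
  have h4N : (1 : ℝ) ≤ 4 ^ N := one_le_pow₀ (by norm_num)
  have h2N : (4 : ℝ) ≤ 2 ^ (N + 2) := by
    rw [pow_add]; nlinarith [one_le_pow₀ (by norm_num : (1 : ℝ) ≤ 2) (n := N)]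
  have hU2 : |U| * ((-h' : ℤ) : ℝ) ≤ 2 * c₀ := by
    have h1 : ((-h' : ℤ) : ℝ) ≤ |(hβ : ℝ)| + 1 := by
      rw [abs_of_nonpos (by exact_mod_cast (hh₁.trans hh₀))]
      have : ((-h' : ℤ) : ℝ) ≤ -(hβ : ℝ) + 1 := by exact_mod_cast (show -h' ≤ -hβ + 1 by omega)
      linarith
    calc |U| * ((-h' : ℤ) : ℝ) ≤ |U| * (|(hβ : ℝ)| + 1) := mul_le_mul_of_nonneg_left h1 (abs_nonneg U)
      _ = |U| * |(hβ : ℝ)| + |U| := by ring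
      _ ≤ c₀ + c₀ := add_le_add hUh hU
      _ = 2 * c₀ := by ring
  split_ifs with h1
  · have h24 : (2 : ℝ) ≤ 2 ^ (N + 2) * 4 ^ N := by
      nlinarith [mul_nonneg (sub_nonneg.2 h2N) (sub_nonneg.2 h4N)]
    have this : (0 : ℝ) ≤ |C k| * c₀ ^ 2 := by positivity
    calc (4 : ℝ) ^ (h * ((k : ℤ) - 1)) * (|C k| * U ^ 2 * 2)
        ≤ 1 * (|C k| * c₀ ^ 2 * 2) := by gcongr
      _ = 2 * (|C k| * c₀ ^ 2) := by ring
      _ ≤ (2 ^ (N + 2) * 4 ^ N) * (|C k| * c₀ ^ 2) := mul_le_mul_of_nonneg_right h24 this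
      _ = 2 ^ (N + 2) * 4 ^ N * |C k| * c₀ ^ 2 := by ring
  · have h2 : 2 ≤ k := by omega
    have hexp : (4 : ℝ) ^ (h * ((k : ℤ) - 1)) * (4 : ℝ) ^ (((k : ℤ) - 2) * (-h')) ≤ 4 ^ N := by
      rw [← zpow_add₀ (by norm_num : (4 : ℝ) ≠ 0), ← zpow_natCast]
      refine zpow_le_zpow_right₀ (by norm_num) ?_
      have : h * ((k : ℤ) - 1) + ((k : ℤ) - 2) * (-h') = h + ((k : ℤ) - 2) * (h - h') := by ring
      rw [this]
      nlinarith [show (k : ℤ) - 2 ≤ N by omega, show (0 : ℤ) ≤ (k : ℤ) - 2 by omega,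
        show h - h' ≤ 1 by omega]
    have hn'0 : (0 : ℝ) ≤ ((-h' : ℤ) : ℝ) := by exact_mod_cast (show (0 : ℤ) ≤ -h' by omega)
    have hsq : ((-h' : ℤ) : ℝ) ^ 2 * U ^ 2 ≤ (2 * c₀) ^ 2 := by
      have h1 : ((-h' : ℤ) : ℝ) ^ 2 * U ^ 2 = (|U| * ((-h' : ℤ) : ℝ)) ^ 2 := by rw [mul_pow, sq_abs]; ring
      rw [h1]
      exact pow_le_pow_left₀ (mul_nonneg (abs_nonneg U) hn'0) hU2 2
    calc (4 : ℝ) ^ (h * ((k : ℤ) - 1)) * (|C k| * U ^ 2 * (((-h' : ℤ) : ℝ) ^ 2 * (4 : ℝ) ^ (((k : ℤ) - 2) * (-h'))))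
        = ((4 : ℝ) ^ (h * ((k : ℤ) - 1)) * (4 : ℝ) ^ (((k : ℤ) - 2) * (-h'))) * |C k| *
            (((-h' : ℤ) : ℝ) ^ 2 * U ^ 2) := by ring
      _ ≤ 4 ^ N * |C k| * (2 * c₀) ^ 2 := by gcongr
      _ = 4 * 4 ^ N * |C k| * c₀ ^ 2 := by ring
      _ ≤ 2 ^ (N + 2) * 4 ^ N * |C k| * c₀ ^ 2 := by gcongr

/-- **The Newton interpolant of `k₀ ↦ E_{h'}(k₀, q⃗)` over `N+1` consecutive Matsubara frequencies has
rescaled derivative bounds `O(1)`**: with `P = newtonInterpolant N (k ↦ E_{h'}(k₀(j₀) + (2π/β)k, q⃗)) k₀(j₀) (2π/β)`,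
`B` the constant of `exists_norm_iteratedDeriv_newtonInterpolant_le ℂ N`, `2π/β ≤ 16e₀γ^h` and
`t` in the node window: `γ^{(l-1)h} ‖P^{(l)}(t)‖ ≤ B max(1,16e₀)^N 2^{N+2} 4^N Σ_{i≤N}|C_i|` (`c₀ ≤ 1`).
[cite: BenfattoGiulianiMastropietro2006, §2.5 proof of Lemma 2.2 (2.56) p0011:L25–L33] -/
theorem norm_iteratedDeriv_newton_dispersion_le (hI : BGMInitial E) (hS : BGMSmoothness β U C hβ E)
    (hβpos : 0 < β) (he : 0 < e₀) (hh₁ : hβ ≤ h) (hh₀ : h ≤ 0) {h' : ℤ} (hh'₁ : h - 1 ≤ h') (hh'₀ : h' ≤ h)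
    (hU : |U| ≤ c₀) (hUh : |U| * |(hβ : ℝ)| ≤ c₀) (hc₁ : c₀ ≤ 1) (hδ : 2 * π / β ≤ 16 * e₀ * (4 : ℝ) ^ h)
    (j₀ : ℤ) (q : Fin 2 → ℝ) (N : ℕ) {B : ℝ} (hB0 : 0 ≤ B)
    (hB : ∀ (f : ℕ → ℂ) (t₀ δ : ℝ), 0 < δ → ∀ l, l ≤ N → ∀ s ∈ Set.Icc t₀ (t₀ + δ * N),
      ‖iteratedDeriv l (newtonInterpolant N f t₀ δ) s‖ ≤
        B * δ⁻¹ ^ l * ∑ k ∈ Finset.Icc l N, ‖((fwdDiff (1 : ℕ))^[k] f) 0‖)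
    {l : ℕ} (hl1 : 1 ≤ l) (hl : l ≤ N) {t : ℝ}
    (ht : t ∈ Icc (fermiMatsubara β j₀) (fermiMatsubara β j₀ + 2 * π / β * N)) :
    (4 : ℝ) ^ (h * ((l : ℤ) - 1)) * ‖iteratedDeriv l (newtonInterpolant N
        (fun k : ℕ => E h' (fermiMatsubara β j₀ + 2 * π / β * k, q)) (fermiMatsubara β j₀) (2 * π / β)) t‖ ≤
      B * (max 1 (16 * e₀)) ^ N * (2 ^ (N + 2) * 4 ^ N * ∑ i ∈ Finset.range (N + 1), |C i|) := by
  have hc₀ : 0 ≤ c₀ := (abs_nonneg U).trans hU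
  set δ : ℝ := 2 * π / β with hδdef
  have hδpos : 0 < δ := by positivity
  have h4h : (0 : ℝ) < (4 : ℝ) ^ h := zpow_pos (by norm_num) _
  have hk₀ : fermiMatsubara β j₀ ∈ matsubaraSet β := ⟨j₀, rfl⟩
  have hCs0 : 0 ≤ ∑ i ∈ Finset.range (N + 1), |C i| := Finset.sum_nonneg fun i _ => abs_nonneg _
  have hm1 : (1 : ℝ) ≤ max 1 (16 * e₀) := le_max_left _ _
  have h4l : (0 : ℝ) < (4 : ℝ) ^ (h * ((l : ℤ) - 1)) := zpow_pos (by norm_num) _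
  -- the interpolation bound
  have h1 := hB (fun k : ℕ => E h' (fermiMatsubara β j₀ + δ * k, q)) (fermiMatsubara β j₀) δ hδpos l hl t ht
  -- each difference through (2.36)
  have hdiff : ∀ k ∈ Finset.Icc l N, ‖((fwdDiff (1 : ℕ))^[k] (fun k : ℕ => E h' (fermiMatsubara β j₀ + δ * k, q))) 0‖ ≤
      δ ^ k * (|C k| * U ^ 2 * (if k = 1 then 2 else ((-h' : ℤ) : ℝ) ^ 2 * (4 : ℝ) ^ (((k : ℤ) - 2) * (-h')))) := by
    intro k hk
    have hk1 : 1 ≤ k := hl1.trans (Finset.mem_Icc.1 hk).1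
    rw [fwdDiff_iter_nat_grid (fun t => E h' (t, q)) (fermiMatsubara β j₀) δ k]
    exact norm_fwdDiff_dispersion_le hI hS hβpos (by omega) (by omega) hk₀ hk1 q
  -- the per-term arithmetic: `γ^{(l-1)h} δ^{-l} δ^k (…) ≤ max(1,16e₀)^N 2^{N+2}4^N |C k| c₀²`
  have hterm : ∀ k ∈ Finset.Icc l N, (4 : ℝ) ^ (h * ((l : ℤ) - 1)) * (δ⁻¹ ^ l * (δ ^ k * (|C k| * U ^ 2 *
      (if k = 1 then 2 else ((-h' : ℤ) : ℝ) ^ 2 * (4 : ℝ) ^ (((k : ℤ) - 2) * (-h')))))) ≤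
      (max 1 (16 * e₀)) ^ N * (2 ^ (N + 2) * 4 ^ N * |C k| * c₀ ^ 2) := by
    intro k hk
    obtain ⟨hlk, hkN⟩ := Finset.mem_Icc.1 hk
    have hk1 : 1 ≤ k := hl1.trans hlk
    -- `δ^{-l} δ^k = δ^{k-l} ≤ (16e₀)^{k-l} 4^{h(k-l)}`
    have hδkl : δ⁻¹ ^ l * δ ^ k = δ ^ (k - l) := by
      rw [inv_pow, pow_sub₀ _ hδpos.ne' hlk]; exact mul_comm _ _
    have hδb : δ ^ (k - l) ≤ (max 1 (16 * e₀)) ^ N * (4 : ℝ) ^ (h * ((k : ℤ) - l)) := by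
      have h0 : δ ^ (k - l) ≤ (16 * e₀ * (4 : ℝ) ^ h) ^ (k - l) := pow_le_pow_left₀ hδpos.le hδ _
      rw [mul_pow, ← zpow_natCast ((4 : ℝ) ^ h), ← zpow_mul, Nat.cast_sub hlk] at h0
      refine h0.trans (mul_le_mul_of_nonneg_right ?_ (zpow_pos (by norm_num) _).le)
      calc (16 * e₀) ^ (k - l) ≤ (max 1 (16 * e₀)) ^ (k - l) := pow_le_pow_left₀ (by positivity) (le_max_right _ _) _
        _ ≤ (max 1 (16 * e₀)) ^ N := pow_le_pow_right₀ hm1 (by omega)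
    have hsa := scale_arith (C := C) hh₁ hh₀ hh'₁ hh'₀ hU hUh hk1 hkN
    have hT0 : 0 ≤ |C k| * U ^ 2 * (if k = 1 then 2 else ((-h' : ℤ) : ℝ) ^ 2 * (4 : ℝ) ^ (((k : ℤ) - 2) * (-h'))) := by
      split_ifs <;> positivity
    have hzz : (4 : ℝ) ^ (h * ((l : ℤ) - 1)) * (4 : ℝ) ^ (h * ((k : ℤ) - l)) = (4 : ℝ) ^ (h * ((k : ℤ) - 1)) := by
      rw [← zpow_add₀ (by norm_num : (4 : ℝ) ≠ 0)]; congr 1; ring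
    calc (4 : ℝ) ^ (h * ((l : ℤ) - 1)) * (δ⁻¹ ^ l * (δ ^ k * (|C k| * U ^ 2 *
          (if k = 1 then 2 else ((-h' : ℤ) : ℝ) ^ 2 * (4 : ℝ) ^ (((k : ℤ) - 2) * (-h'))))))
        = (4 : ℝ) ^ (h * ((l : ℤ) - 1)) * (δ⁻¹ ^ l * δ ^ k) * (|C k| * U ^ 2 *
          (if k = 1 then 2 else ((-h' : ℤ) : ℝ) ^ 2 * (4 : ℝ) ^ (((k : ℤ) - 2) * (-h')))) := by ring
      _ ≤ (4 : ℝ) ^ (h * ((l : ℤ) - 1)) * ((max 1 (16 * e₀)) ^ N * (4 : ℝ) ^ (h * ((k : ℤ) - l))) * (|C k| * U ^ 2 *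
          (if k = 1 then 2 else ((-h' : ℤ) : ℝ) ^ 2 * (4 : ℝ) ^ (((k : ℤ) - 2) * (-h')))) := by
          rw [hδkl]; gcongr
      _ = (max 1 (16 * e₀)) ^ N * (((4 : ℝ) ^ (h * ((l : ℤ) - 1)) * (4 : ℝ) ^ (h * ((k : ℤ) - l))) * (|C k| * U ^ 2 *
          (if k = 1 then 2 else ((-h' : ℤ) : ℝ) ^ 2 * (4 : ℝ) ^ (((k : ℤ) - 2) * (-h'))))) := by ring
      _ ≤ (max 1 (16 * e₀)) ^ N * (2 ^ (N + 2) * 4 ^ N * |C k| * c₀ ^ 2) := by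
          rw [hzz]; exact mul_le_mul_of_nonneg_left hsa (by positivity)
  -- sum up
  have hCle : ∑ k ∈ Finset.Icc l N, |C k| ≤ ∑ i ∈ Finset.range (N + 1), |C i| :=
    Finset.sum_le_sum_of_subset_of_nonneg (fun k hk => by
      rw [Finset.mem_Icc] at hk; rw [Finset.mem_range]; omega) (fun i _ _ => abs_nonneg _)
  have hc2 : c₀ ^ 2 ≤ 1 := by nlinarith
  calc (4 : ℝ) ^ (h * ((l : ℤ) - 1)) * ‖iteratedDeriv l (newtonInterpolant N
        (fun k : ℕ => E h' (fermiMatsubara β j₀ + δ * k, q)) (fermiMatsubara β j₀) δ) t‖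
      ≤ (4 : ℝ) ^ (h * ((l : ℤ) - 1)) * (B * δ⁻¹ ^ l * ∑ k ∈ Finset.Icc l N, δ ^ k * (|C k| * U ^ 2 *
          (if k = 1 then 2 else ((-h' : ℤ) : ℝ) ^ 2 * (4 : ℝ) ^ (((k : ℤ) - 2) * (-h'))))) := by
        refine mul_le_mul_of_nonneg_left (h1.trans ?_) h4l.le
        exact mul_le_mul_of_nonneg_left (Finset.sum_le_sum hdiff) (by positivity)
    _ = B * ∑ k ∈ Finset.Icc l N, (4 : ℝ) ^ (h * ((l : ℤ) - 1)) * (δ⁻¹ ^ l * (δ ^ k * (|C k| * U ^ 2 *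
          (if k = 1 then 2 else ((-h' : ℤ) : ℝ) ^ 2 * (4 : ℝ) ^ (((k : ℤ) - 2) * (-h')))))) := by
        rw [Finset.mul_sum, Finset.mul_sum, Finset.mul_sum]
        refine Finset.sum_congr rfl fun k _ => ?_; ring
    _ ≤ B * ∑ k ∈ Finset.Icc l N, (max 1 (16 * e₀)) ^ N * (2 ^ (N + 2) * 4 ^ N * |C k| * c₀ ^ 2) :=
        mul_le_mul_of_nonneg_left (Finset.sum_le_sum hterm) hB0
    _ = B * (max 1 (16 * e₀)) ^ N * (2 ^ (N + 2) * 4 ^ N * ∑ k ∈ Finset.Icc l N, |C k|) * c₀ ^ 2 := by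
        rw [Finset.mul_sum, Finset.mul_sum]
        simp only [Finset.mul_sum, Finset.sum_mul]
        refine Finset.sum_congr rfl fun k _ => ?_; ring
    _ ≤ B * (max 1 (16 * e₀)) ^ N * (2 ^ (N + 2) * 4 ^ N * ∑ i ∈ Finset.range (N + 1), |C i|) * 1 := by gcongr
    _ = _ := by ring


/-- Derivatives of order `≥ 1` of `t ↦ -ik₀... : -i t + (P(t) - μ)`: `≤ 1 + ‖P^{(i)}(t)‖` (the linear time part
contributes only at order one). [folklore] -/
private theorem norm_iteratedDeriv_time_denom_le {P : ℝ → ℂ} {n : ℕ} (hP : ContDiff ℝ n P) (μ' : ℂ) {i : ℕ} (hi : 1 ≤ i)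
    (hin : i ≤ n) (t : ℝ) :
    ‖iteratedDeriv i (fun t : ℝ => -(Complex.I * (t : ℂ)) + (P t - μ')) t‖ ≤ 1 + ‖iteratedDeriv i P t‖ := by
  have hfun : (fun t : ℝ => -(Complex.I * (t : ℂ)) + (P t - μ')) =
      fun t => (-μ') + ((fun s : ℝ => s • (-Complex.I)) t + P t) := by
    funext t; simp only [Complex.real_smul]; ring
  have hlin : ContDiff ℝ i (fun s : ℝ => s • (-Complex.I)) := contDiff_id.smul contDiff_const
  have hPi : ContDiff ℝ i P := hP.of_le (by exact_mod_cast hin)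
  rw [hfun, iteratedDeriv_const_add hi, iteratedDeriv_fun_add hlin.contDiffAt hPi.contDiffAt]
  have h1 : ‖iteratedDeriv i (fun s : ℝ => s • (-Complex.I)) t‖ ≤ 1 := by
    rw [iteratedDeriv_smul_const (contDiffAt_id (n := i)) (-Complex.I),
      show (fun s : ℝ => s) = id from rfl, iteratedDeriv_id, if_neg (by omega)]
    split_ifs <;> simp
  calc _ ≤ ‖iteratedDeriv i (fun s : ℝ => s • (-Complex.I)) t‖ + ‖iteratedDeriv i P t‖ := norm_add_le _ _
    _ ≤ 1 + ‖iteratedDeriv i P t‖ := by gcongr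

/-- Rescaled affine reparametrisation: `∂_σⁱ G(t₀ + cσ) = cⁱ G^{(i)}(t₀ + cσ)`. [folklore] -/
private theorem iteratedDeriv_comp_affine (G : ℝ → ℂ) {n : ℕ} (hG : ContDiff ℝ n G) (t₀ c : ℝ) {i : ℕ} (hi : i ≤ n)
    (σ : ℝ) : iteratedDeriv i (fun σ : ℝ => G (t₀ + c * σ)) σ = c ^ i • iteratedDeriv i G (t₀ + c * σ) := by
  have hH : ContDiff ℝ i (fun x : ℝ => G (t₀ + x)) :=
    (hG.comp (contDiff_const.add contDiff_id)).of_le (by exact_mod_cast hi)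
  have h1 := congrFun (iteratedDeriv_comp_const_smul hH c) σ
  rw [h1, iteratedDeriv_comp_const_add]

/-- **Order zero across a window from one good point** (mean value inequality): if `‖a'‖ ≤ A₁` on
`[0, L]` and `‖a(σ₀)‖ ≤ A₀` at some `σ₀ ∈ [0, L]`, then `‖a‖ ≤ A₀ + A₁L` on `[0, L]`. [folklore] -/
private theorem norm_le_of_deriv_window {a : ℝ → ℂ} {L A₀ A₁ : ℝ} (ha : ContDiff ℝ 1 a)
    (hA₁ : ∀ σ ∈ Icc (0 : ℝ) L, ‖iteratedDeriv 1 a σ‖ ≤ A₁) {σ₀ : ℝ} (hσ₀ : σ₀ ∈ Icc (0 : ℝ) L)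
    (h0 : ‖a σ₀‖ ≤ A₀) {σ : ℝ} (hσ : σ ∈ Icc (0 : ℝ) L) : ‖a σ‖ ≤ A₀ + A₁ * L := by
  have hdiff : ∀ x ∈ Icc (0 : ℝ) L, DifferentiableAt ℝ a x := fun x _ => ha.differentiable one_ne_zero x
  have hbound : ∀ x ∈ Icc (0 : ℝ) L, ‖deriv a x‖ ≤ A₁ := fun x hx => by rw [← iteratedDeriv_one]; exact hA₁ x hx
  have hmvt := (convex_Icc 0 L).norm_image_sub_le_of_norm_deriv_le hdiff hbound hσ₀ hσ
  have hL : ‖σ - σ₀‖ ≤ L := by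
    rw [Real.norm_eq_abs, abs_le]; constructor <;> linarith [hσ.1, hσ.2, hσ₀.1, hσ₀.2]
  have hA₁0 : 0 ≤ A₁ := (norm_nonneg _).trans (hA₁ σ₀ hσ₀)
  calc ‖a σ‖ = ‖a σ₀ + (a σ - a σ₀)‖ := by rw [add_sub_cancel]
    _ ≤ ‖a σ₀‖ + ‖a σ - a σ₀‖ := norm_add_le _ _
    _ ≤ A₀ + A₁ * L := add_le_add h0 (hmvt.trans (mul_le_mul_of_nonneg_left hL hA₁0))

/-- **Lemma 2.2/2.3, the Matsubara direction — `N`-th differences of the slices along the frequency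
lattice.** For admissible data and every `N`, `0 ≤ c₀ ≤ 1` there is `K ≥ 0` such that: under `E_0 = ε₀`,
(2.36) with `|U| ≤ c₀`, `|U||h_β| ≤ c₀`, `|C₀|c₀ ≤ (3/16)e₀`, for every scale `h_β ≤ h ≤ 0` with
`2π/β ≤ 16e₀γ^h` (automatic when the support of `f_h` meets the Matsubara lattice), every angular index
`m, ω`, every `j₀ ∈ ℤ` and every `q⃗`:
`‖Δ₁ᴺ (j ↦ F_{h,ω}(k₀(j), q⃗)/D_{h-1}(k₀(j), q⃗))(j₀)‖ ≤ K (2π/β)ᴺ γ^{-h} γ^{-Nh}`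
— each discrete `k₀`-derivative `(β/2π)Δ` costs `γ^{-h}`: the mechanism of the `γ^h|d_β(x₀)|` factor of
(2.52)/(2.60) after Matsubara summation by parts.  Device: the Newton interpolant of `k₀ ↦ E_h(k₀, q⃗)`
through the `N+1` nodes (so that BGM's discrete hypothesis (2.36aa) suffices), the surrogates of §1 and the
mean value theorem across the window. [cite: BenfattoGiulianiMastropietro2006, §2.5 proof of Lemma 2.2 (2.56) p0011:L25–L33, Lemma 2.3 (2.60) p0011:L154] -/
theorem exists_norm_fwdDiff_sectorIntegrand_le {μ e₀ : ℝ} (he : 0 < e₀) (C : ℕ → ℝ) (N : ℕ) {c₀ : ℝ}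
    (hc₁ : c₀ ≤ 1) :
    ∃ K : ℝ, 0 ≤ K ∧ ∀ (β U : ℝ) (hβ : ℤ) (E : ℤ → ℝ × (Fin 2 → ℝ) → ℂ), 0 < β →
      BGMInitial E → BGMSmoothness β U C hβ E → |U| ≤ c₀ → |U| * |(hβ : ℝ)| ≤ c₀ → |C 0| * c₀ ≤ 3 / 16 * e₀ →
      ∀ h : ℤ, hβ ≤ h → h ≤ 0 → 2 * π / β ≤ 16 * e₀ * (4 : ℝ) ^ h →
      ∀ (m : ℕ) (ω : ℤ) (j₀ : ℤ) (q : Fin 2 → ℝ),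
      ‖((fwdDiff (1 : ℤ))^[N] (fun j : ℤ => ((bgmSectorFn e₀ μ E h m ω (fermiMatsubara β j, q) : ℝ) : ℂ) /
          bgmDenom μ E (h - 1) (fermiMatsubara β j, q))) j₀‖ ≤
        K * (2 * π / β) ^ N * ((4 : ℝ) ^ (-h) * (4 : ℝ) ^ (-((N : ℤ) * h))) := by
  -- constants
  obtain ⟨B, hB0, hB⟩ := exists_norm_iteratedDeriv_newtonInterpolant_le ℂ N
  obtain ⟨AP, hAP⟩ : ∃ AP : ℝ, AP = B * (max 1 (16 * e₀)) ^ N *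
    (2 ^ (N + 2) * 4 ^ N * ∑ i ∈ Finset.range (N + 1), |C i|) := ⟨_, rfl⟩
  have hAP0 : 0 ≤ AP := by
    have := Finset.sum_nonneg (fun i (_ : i ∈ Finset.range (N + 1)) => abs_nonneg (C i))
    rw [hAP]; positivity
  obtain ⟨M, hM⟩ : ∃ M : ℝ, M = 2 * e₀ + (1 + AP) * (16 * N * e₀) + (1 + AP) := ⟨_, rfl⟩
  obtain ⟨K, hK0, hK⟩ := exists_norm_iteratedDeriv_surrogateProduct_le he N M 1
  refine ⟨K, hK0, ?_⟩
  intro β U hβ E hβpos hI hS hU hUh hK₀ h hh₁ hh₀ hδ m ω j₀ q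
  have hc₀ : 0 ≤ c₀ := (abs_nonneg U).trans hU
  have hδpos : 0 < 2 * π / β := by positivity
  have hnode : ∀ k : ℕ, fermiMatsubara β (j₀ + k) = fermiMatsubara β j₀ + (2 * π / β) * k := fun k => fermiMatsubara_add_nat β j₀ k
  have h4h : (0 : ℝ) < (4 : ℝ) ^ h := zpow_pos (by norm_num) _
  have h4n : (0 : ℝ) < (4 : ℝ) ^ (-h) := zpow_pos (by norm_num) _
  have h44 : (4 : ℝ) ^ h * (4 : ℝ) ^ (-h) = 1 := by rw [zpow_neg, mul_inv_cancel₀ h4h.ne']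
  have hRHS0 : 0 ≤ K * (2 * π / β) ^ N * ((4 : ℝ) ^ (-h) * (4 : ℝ) ^ (-((N : ℤ) * h))) := by positivity
  -- the slices at the nodes
  obtain ⟨Φ, hΦ⟩ : ∃ Φ : ℤ → ℂ, Φ = fun j => ((bgmSectorFn e₀ μ E h m ω (fermiMatsubara β j, q) : ℝ) : ℂ) /
    bgmDenom μ E (h - 1) (fermiMatsubara β j, q) := ⟨_, rfl⟩
  rw [← hΦ]
  -- the `N`-th difference as the alternating binomial sum over the nodes `j₀ + k`
  have hsum : ((fwdDiff (1 : ℤ))^[N] Φ) j₀ =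
      ∑ k ∈ Finset.range (N + 1), ((-1 : ℤ) ^ (N - k) * N.choose k) • Φ (j₀ + k) := by
    rw [fwdDiff_iter_eq_sum_shift]; simp
  by_cases hex : ∃ k, k ≤ N ∧ bgmShell e₀ μ E h (fermiMatsubara β (j₀ + k), q) ≠ 0
  swap
  · -- no node meets the support: every slice vanishes
    push Not at hex
    have h0 : ∀ k ∈ Finset.range (N + 1), ((-1 : ℤ) ^ (N - k) * N.choose k) • Φ (j₀ + k) = 0 := by
      intro k hk
      have hk' : k ≤ N := Nat.lt_succ_iff.1 (Finset.mem_range.1 hk)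
      have : Φ (j₀ + k) = 0 := by
        rw [hΦ]; simp only [bgmSectorFn, hex k hk', zero_mul, Complex.ofReal_zero, zero_div]
      rw [this, smul_zero]
    rw [hsum, Finset.sum_eq_zero h0, norm_zero]
    exact hRHS0
  obtain ⟨kstar, hkstar, hfstar⟩ := hex
  -- the Newton interpolants of `k₀ ↦ E_{h'}(k₀, q⃗)`, `h' = h, h-1`
  obtain ⟨P, hP⟩ : ∃ P : ℤ → ℝ → ℂ, P = fun h' => newtonInterpolant N
    (fun k : ℕ => E h' (fermiMatsubara β j₀ + (2 * π / β) * k, q)) (fermiMatsubara β j₀) (2 * π / β) := ⟨_, rfl⟩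
  have hPc : ∀ (h' : ℤ) (n : ℕ), ContDiff ℝ n (P h') := fun h' n => by rw [hP]; exact contDiff_newtonInterpolant _ _ _ _
  have hPnode : ∀ (h' : ℤ) (k : ℕ), k ≤ N → P h' (fermiMatsubara β j₀ + (2 * π / β) * k) = E h' (fermiMatsubara β j₀ + (2 * π / β) * k, q) := fun h' k hk => by
    rw [hP]; exact newtonInterpolant_node N _ _ hδpos.ne' hk
  -- the rescaled curves and the surrogate product
  obtain ⟨cur, hcur⟩ : ∃ cur : ℤ → ℝ → ℂ, cur = fun h' σ => (((4 : ℝ) ^ (-h) : ℝ) : ℂ) *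
    (-(Complex.I * (((fermiMatsubara β j₀ + (4 : ℝ) ^ h * σ : ℝ)) : ℂ)) + (P h' (fermiMatsubara β j₀ + (4 : ℝ) ^ h * σ) - (μ : ℂ))) := ⟨_, rfl⟩
  obtain ⟨ζ, hζ⟩ : ∃ ζ : ℝ, ζ = sectorWeightCirc m ω (polarAngle q) := ⟨_, rfl⟩
  obtain ⟨ψ, hψ⟩ : ∃ ψ : ℝ → ℂ, ψ = fun σ => ((bgmShellSurrogate e₀ (cur h σ) (cur (h - 1) σ) * ζ : ℝ) : ℂ) *
    bgmInvSurrogate e₀ (cur (h - 1) σ) := ⟨_, rfl⟩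
  have hcurc : ∀ (h' : ℤ) (n : ℕ), ContDiff ℝ n (cur h') := fun h' n => by
    rw [hcur]
    have h0 : ContDiff ℝ n fun σ : ℝ => fermiMatsubara β j₀ + (4 : ℝ) ^ h * σ := contDiff_const.add (contDiff_const.mul contDiff_id)
    have h1 : ContDiff ℝ n fun σ : ℝ => (((fermiMatsubara β j₀ + (4 : ℝ) ^ h * σ : ℝ)) : ℂ) := Complex.ofRealCLM.contDiff.comp h0
    have h2 : ContDiff ℝ n fun σ : ℝ => P h' (fermiMatsubara β j₀ + (4 : ℝ) ^ h * σ) := (hPc h' n).comp h0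
    exact contDiff_const.mul ((contDiff_const.mul h1).neg.add (h2.sub contDiff_const))
  -- at the nodes the curves ARE the rescaled denominators
  have hcur_node : ∀ (h' : ℤ) (k : ℕ), k ≤ N →
      cur h' ((4 : ℝ) ^ (-h) * ((2 * π / β) * k)) =
        (((4 : ℝ) ^ (-h) : ℝ) : ℂ) * bgmDenom μ E h' (fermiMatsubara β (j₀ + k), q) := by
    intro h' k hk
    have ht : fermiMatsubara β j₀ + (4 : ℝ) ^ h * ((4 : ℝ) ^ (-h) * ((2 * π / β) * k)) = fermiMatsubara β j₀ + (2 * π / β) * k := by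
      rw [← mul_assoc, h44, one_mul]
    rw [hcur]
    simp only [ht, hPnode h' k hk, hnode k, bgmDenom]
  -- derivative bounds of the curves on the window `[0, L]`, `L = γ^{-h} N δ ≤ 16 N e₀`
  obtain ⟨L, hL⟩ : ∃ L : ℝ, L = (4 : ℝ) ^ (-h) * ((2 * π / β) * N) := ⟨_, rfl⟩
  have hL0 : 0 ≤ L := by rw [hL]; positivity
  have hL16 : L ≤ 16 * N * e₀ := by
    rw [hL]
    calc (4 : ℝ) ^ (-h) * ((2 * π / β) * N) ≤ (4 : ℝ) ^ (-h) * (16 * e₀ * (4 : ℝ) ^ h * N) := by gcongr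
      _ = 16 * N * e₀ * ((4 : ℝ) ^ h * (4 : ℝ) ^ (-h)) := by ring
      _ = 16 * N * e₀ := by rw [h44, mul_one]
  have hwin : ∀ σ ∈ Icc (0 : ℝ) L, fermiMatsubara β j₀ + (4 : ℝ) ^ h * σ ∈ Icc (fermiMatsubara β j₀) (fermiMatsubara β j₀ + (2 * π / β) * N) := by
    intro σ hσ
    refine ⟨by nlinarith [hσ.1, h4h], ?_⟩
    have := mul_le_mul_of_nonneg_left hσ.2 h4h.le
    rw [hL, ← mul_assoc, h44, one_mul] at this
    linarith
  have hderiv : ∀ (h' : ℤ), h - 1 ≤ h' → h' ≤ h → ∀ (l : ℕ), 1 ≤ l → l ≤ N → ∀ σ ∈ Icc (0 : ℝ) L,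
      ‖iteratedDeriv l (cur h') σ‖ ≤ 1 + AP := by
    intro h' hh'₁ hh'₀ l hl1 hl σ hσ
    obtain ⟨G, hG⟩ : ∃ G : ℝ → ℂ, G = fun t : ℝ => -(Complex.I * ((t : ℝ) : ℂ)) + (P h' t - (μ : ℂ)) := ⟨_, rfl⟩
    have hGc : ContDiff ℝ N G := by
      rw [hG]; exact ((contDiff_const.mul Complex.ofRealCLM.contDiff).neg).add ((hPc h' N).sub contDiff_const)
    have hcurG : cur h' = fun σ => (((4 : ℝ) ^ (-h) : ℝ) : ℂ) * G (fermiMatsubara β j₀ + (4 : ℝ) ^ h * σ) := by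
      rw [hcur, hG]
    have hGl : ContDiff ℝ l (fun σ : ℝ => G (fermiMatsubara β j₀ + (4 : ℝ) ^ h * σ)) :=
      (hGc.of_le (by exact_mod_cast hl)).comp (contDiff_const.add (contDiff_const.mul contDiff_id))
    rw [hcurG, iteratedDeriv_const_mul _ hGl.contDiffAt, iteratedDeriv_comp_affine G hGc _ _ hl, norm_mul,
      Complex.norm_real, Real.norm_of_nonneg h4n.le, norm_smul, norm_pow, Real.norm_of_nonneg h4h.le]
    have hGb : ‖iteratedDeriv l G (fermiMatsubara β j₀ + (4 : ℝ) ^ h * σ)‖ ≤ 1 + ‖iteratedDeriv l (P h') (fermiMatsubara β j₀ + (4 : ℝ) ^ h * σ)‖ := by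
      rw [hG]; exact norm_iteratedDeriv_time_denom_le (hPc h' N) _ hl1 hl _
    have hPb : (4 : ℝ) ^ (h * ((l : ℤ) - 1)) * ‖iteratedDeriv l (P h') (fermiMatsubara β j₀ + (4 : ℝ) ^ h * σ)‖ ≤ AP := by
      rw [hAP, hP]
      exact norm_iteratedDeriv_newton_dispersion_le hI hS hβpos he hh₁ hh₀ hh'₁ hh'₀ hU hUh hc₁ hδ
        j₀ q N hB0 hB hl1 hl (hwin σ hσ)
    -- `γ^{-h} (γ^h)^l = γ^{h(l-1)} ≤ 1`
    have hsc : (4 : ℝ) ^ (-h) * ((4 : ℝ) ^ h) ^ l = (4 : ℝ) ^ (h * ((l : ℤ) - 1)) := by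
      rw [← zpow_natCast, ← zpow_mul, ← zpow_add₀ (by norm_num : (4 : ℝ) ≠ 0)]; congr 1; ring
    have hsc1 : (4 : ℝ) ^ (h * ((l : ℤ) - 1)) ≤ 1 :=
      zpow_le_one_of_nonpos₀ (by norm_num) (mul_nonpos_of_nonpos_of_nonneg hh₀ (by omega))
    have h4l : (0 : ℝ) ≤ (4 : ℝ) ^ (h * ((l : ℤ) - 1)) := (zpow_pos (by norm_num) _).le
    calc (4 : ℝ) ^ (-h) * (((4 : ℝ) ^ h) ^ l * ‖iteratedDeriv l G (fermiMatsubara β j₀ + (4 : ℝ) ^ h * σ)‖)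
        = (4 : ℝ) ^ (h * ((l : ℤ) - 1)) * ‖iteratedDeriv l G (fermiMatsubara β j₀ + (4 : ℝ) ^ h * σ)‖ := by
          rw [← mul_assoc, hsc]
      _ ≤ (4 : ℝ) ^ (h * ((l : ℤ) - 1)) * (1 + ‖iteratedDeriv l (P h') (fermiMatsubara β j₀ + (4 : ℝ) ^ h * σ)‖) :=
          mul_le_mul_of_nonneg_left hGb h4l
      _ = (4 : ℝ) ^ (h * ((l : ℤ) - 1)) * 1 +
          (4 : ℝ) ^ (h * ((l : ℤ) - 1)) * ‖iteratedDeriv l (P h') (fermiMatsubara β j₀ + (4 : ℝ) ^ h * σ)‖ := by ring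
      _ ≤ 1 * 1 + AP := add_le_add (mul_le_mul_of_nonneg_right hsc1 zero_le_one) hPb
      _ = 1 + AP := by ring
  -- order zero across the window, from the good node `kstar`
  obtain ⟨σs, hσs⟩ : ∃ σs : ℝ, σs = (4 : ℝ) ^ (-h) * ((2 * π / β) * kstar) := ⟨_, rfl⟩
  have hσsI : σs ∈ Icc (0 : ℝ) L := by
    rw [hσs, hL]
    refine ⟨by positivity, mul_le_mul_of_nonneg_left ?_ h4n.le⟩
    exact mul_le_mul_of_nonneg_left (by exact_mod_cast hkstar) hδpos.le
  have hk₀s : fermiMatsubara β (j₀ + kstar) ∈ matsubaraSet β := ⟨j₀ + kstar, rfl⟩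
  have hηs := norm_E_sub_E_le_threshold hS hh₁ hh₀ hUh hK₀ hk₀s q
  have hzero : ∀ (h' : ℤ), h - 1 ≤ h' → h' ≤ h → ∀ σ ∈ Icc (0 : ℝ) L,
      ‖cur h' σ‖ ≤ 2 * e₀ + (1 + AP) * (16 * N * e₀) := by
    intro h' hh'₁ hh'₀ σ hσ
    have hcs : ‖cur h' σs‖ ≤ 2 * e₀ := by
      rw [hσs, hcur_node h' kstar hkstar, norm_mul, Complex.norm_real, Real.norm_of_nonneg h4n.le]
      have hb2 : ‖bgmDenom μ E h' (fermiMatsubara β (j₀ + ↑kstar), q)‖ ≤ 2 * e₀ * (4 : ℝ) ^ h := by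
        rcases (show h' = h ∨ h' = h - 1 by omega) with rfl | rfl
        · have := (norm_bgmDenom_self_lt_of_bgmShell_ne_zero he hηs hfstar).le
          nlinarith [he, h4h]
        · exact (norm_bgmDenom_bounds_of_bgmShell_ne_zero he hηs hfstar).2.le
      calc (4 : ℝ) ^ (-h) * ‖bgmDenom μ E h' (fermiMatsubara β (j₀ + ↑kstar), q)‖
          ≤ (4 : ℝ) ^ (-h) * (2 * e₀ * (4 : ℝ) ^ h) := mul_le_mul_of_nonneg_left hb2 h4n.le
        _ = 2 * e₀ * ((4 : ℝ) ^ h * (4 : ℝ) ^ (-h)) := by ring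
        _ = 2 * e₀ := by rw [h44, mul_one]
    have hextra : 0 ≤ (1 + AP) * (16 * N * e₀) := by positivity
    rcases Nat.eq_zero_or_pos N with hN0 | hNpos
    · -- a one-point window
      have hL0' : L = 0 := by rw [hL, hN0]; simp
      have hσ0 : σ = σs := by
        have h1 := hσ; have h2 := hσsI
        rw [hL0'] at h1 h2
        linarith [h1.1, h1.2, h2.1, h2.2]
      rw [hσ0]
      linarith
    · have h1 := norm_le_of_deriv_window (hcurc h' 1)
        (fun σ' hσ' => hderiv h' hh'₁ hh'₀ 1 le_rfl hNpos σ' hσ') hσsI hcs hσ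
      calc ‖cur h' σ‖ ≤ 2 * e₀ + (1 + AP) * L := h1
        _ ≤ 2 * e₀ + (1 + AP) * (16 * N * e₀) := by gcongr
  -- all orders `≤ N` on the window: `≤ M`
  have hMcur : ∀ (h' : ℤ), h - 1 ≤ h' → h' ≤ h → ∀ σ ∈ Icc (0 : ℝ) L, ∀ l ≤ N, ‖iteratedDeriv l (cur h') σ‖ ≤ M := by
    intro h' hh'₁ hh'₀ σ hσ l hl
    rw [hM]
    rcases Nat.eq_zero_or_pos l with rfl | hl1
    · rw [iteratedDeriv_zero]
      have := hzero h' hh'₁ hh'₀ σ hσ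
      linarith
    · have := hderiv h' hh'₁ hh'₀ l hl1 hl σ hσ
      nlinarith [he, hAP0]
  -- the constant angular factor
  have hZ : ∀ (σ : ℝ), ∀ j ≤ N, ‖iteratedDeriv j (fun _ : ℝ => ζ) σ‖ ≤ 1 := by
    intro σ j _
    rw [iteratedDeriv_const]
    split_ifs
    · rw [hζ, Real.norm_eq_abs, abs_of_nonneg (sectorWeightCirc_nonneg _ _ _)]
      exact sectorWeightCirc_le_one _ _ _
    · rw [norm_zero]; exact zero_le_one
  have hψc : ContDiff ℝ N ψ := by
    rw [hψ]
    exact (Complex.ofRealCLM.contDiff.comp ((contDiff_bgmShellSurrogate_comp he (hcurc h N) (hcurc (h - 1) N)).mul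
      contDiff_const)).mul (contDiff_bgmInvSurrogate_comp he (hcurc (h - 1) N))
  have hψb : ∀ σ ∈ Icc (0 : ℝ) L, ‖iteratedDeriv N ψ σ‖ ≤ K := by
    intro σ hσ
    rw [hψ]
    exact hK (cur h) (cur (h - 1)) (fun _ => ζ) σ (hcurc h N) (hcurc (h - 1) N) contDiff_const
      (hMcur h (by omega) le_rfl σ hσ) (hMcur (h - 1) le_rfl (by omega) σ hσ) (hZ σ) N le_rfl
  -- the smooth function of the frequency through the nodes
  obtain ⟨Ψ, hΨ⟩ : ∃ Ψ : ℝ → ℂ, Ψ = fun t => (((4 : ℝ) ^ (-h) : ℝ) : ℂ) *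
    ψ (-((4 : ℝ) ^ (-h) * fermiMatsubara β j₀) + (4 : ℝ) ^ (-h) * t) := ⟨_, rfl⟩
  have hΨc : ContDiff ℝ N Ψ := by
    rw [hΨ]; exact contDiff_const.mul (hψc.comp (contDiff_const.add (contDiff_const.mul contDiff_id)))
  have hΨnode : ∀ k ∈ Finset.range (N + 1), Ψ (fermiMatsubara β j₀ + k • (2 * π / β)) = Φ (j₀ + k) := by
    intro k hk
    have hk' : k ≤ N := Nat.lt_succ_iff.1 (Finset.mem_range.1 hk)
    have harg : -((4 : ℝ) ^ (-h) * fermiMatsubara β j₀) + (4 : ℝ) ^ (-h) * (fermiMatsubara β j₀ + k • (2 * π / β)) =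
        (4 : ℝ) ^ (-h) * ((2 * π / β) * k) := by rw [nsmul_eq_mul]; ring
    have hk₀k : fermiMatsubara β (j₀ + k) ∈ matsubaraSet β := ⟨j₀ + k, rfl⟩
    have hηk := norm_E_sub_E_le_threshold hS hh₁ hh₀ hUh hK₀ hk₀k q
    rw [hΨ, hΦ]
    simp only
    rw [harg, hψ]
    simp only
    rw [hcur_node h k hk', hcur_node (h - 1) k hk', sectorIntegrand_eq_surrogate he hηk m ω, hζ]
    ring
  have hdiffeq : ((fwdDiff (1 : ℤ))^[N] Φ) j₀ = ((fwdDiff (2 * π / β))^[N] Ψ) (fermiMatsubara β j₀) := by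
    rw [hsum, fwdDiff_iter_eq_sum_shift]
    refine Finset.sum_congr rfl fun k hk => ?_
    rw [hΨnode k hk]
  -- the `N`-th derivative of `Ψ` on the window
  have hΨderiv : ∀ s ∈ Icc (fermiMatsubara β j₀) (fermiMatsubara β j₀ + N * (2 * π / β)),
      ‖iteratedDeriv N Ψ s‖ ≤ K * ((4 : ℝ) ^ (-h) * (4 : ℝ) ^ (-((N : ℤ) * h))) := by
    intro s hs
    have hσ : -((4 : ℝ) ^ (-h) * fermiMatsubara β j₀) + (4 : ℝ) ^ (-h) * s ∈ Icc (0 : ℝ) L := by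
      rw [hL]
      have e1 : -((4 : ℝ) ^ (-h) * fermiMatsubara β j₀) + (4 : ℝ) ^ (-h) * s = (4 : ℝ) ^ (-h) * (s - fermiMatsubara β j₀) := by ring
      rw [e1]
      refine ⟨mul_nonneg h4n.le (by linarith [hs.1]), mul_le_mul_of_nonneg_left (by linarith [hs.2]) h4n.le⟩
    have hF : ContDiff ℝ N (fun t : ℝ => ψ (-((4 : ℝ) ^ (-h) * fermiMatsubara β j₀) + (4 : ℝ) ^ (-h) * t)) :=
      hψc.comp (contDiff_const.add (contDiff_const.mul contDiff_id))
    rw [hΨ, iteratedDeriv_const_mul _ hF.contDiffAt,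
      iteratedDeriv_comp_affine ψ hψc _ _ le_rfl, norm_mul, Complex.norm_real, Real.norm_of_nonneg h4n.le,
      norm_smul, norm_pow, Real.norm_of_nonneg h4n.le]
    have hz : ((4 : ℝ) ^ (-h)) ^ N = (4 : ℝ) ^ (-((N : ℤ) * h)) := by
      rw [← zpow_natCast, ← zpow_mul]; congr 1; ring
    rw [hz]
    calc (4 : ℝ) ^ (-h) * ((4 : ℝ) ^ (-((N : ℤ) * h)) * ‖iteratedDeriv N ψ (-((4 : ℝ) ^ (-h) * fermiMatsubara β j₀) + (4 : ℝ) ^ (-h) * s)‖)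
        ≤ (4 : ℝ) ^ (-h) * ((4 : ℝ) ^ (-((N : ℤ) * h)) * K) := by gcongr; exact hψb _ hσ
      _ = K * ((4 : ℝ) ^ (-h) * (4 : ℝ) ^ (-((N : ℤ) * h))) := by ring
  have hmain := norm_fwdDiff_iter_le_of_norm_iteratedDeriv_le N Ψ hΨc hδpos.le (fermiMatsubara β j₀) hΨderiv
  rw [hdiffeq]
  calc _ ≤ (2 * π / β) ^ N * (K * ((4 : ℝ) ^ (-h) * (4 : ℝ) ^ (-((N : ℤ) * h)))) := hmain
    _ = K * (2 * π / β) ^ N * ((4 : ℝ) ^ (-h) * (4 : ℝ) ^ (-((N : ℤ) * h))) := by ring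

end Standing

end Literature.MathematicalPhysics.QuantumLattice.FermiRG

end
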